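import Literature.Topology.FourManifolds.CrossingRetraction
import Literature.Topology.FourManifolds.BandLoopToEdge
import Literature.Topology.FourManifolds.KnotsIsotopyProofs
import HarnessLib

/-!
# From the retracted host to the first summand: cleaning the arches and the edge loop

Topic `Literature/Topology/FourManifolds` (trunk T-4MAN). Fact seat
`provefact-Literature.Topology.FourManifolds.Knot.IsConnectedSum.isIsotopic` (Schubert's theorem),
geometric heart for rail knots, closure step (conclusion). After the crossing retraction
(`CrossingRetraction.lean`) the instance host is isotopic to the knot `k♮ = P.outKnot …`, which is
`A` off the band window `[alo, ahi]` and inside it the band image of a planar track: the necked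
lower rail arch, the planar path `(1/2, 1/2) + κ hh` on the moving interval, the necked upper rail
arch. Here

* the heights of the two necked arches are homotoped (same first coordinate, straight line in the
  height) to *clean* monotone profiles — one planar family of modifications in the band
  (`BandData.PlanarFamily`, `PlanarBandFamily.lean`), giving `k♭`;
* `k♭` is an *edge loop* (`BandData.EdgeLoop`, `BandLoopToEdge.lean`): heights non-decreasing,
  the turning condition about the height `1/2` (for `κ tgtLip ≤ 1`), so `k♭` is isotopic to `A`.

Main result: `BandData.HostHyp.isIsotopic_host_A : P.host.IsIsotopic A`.

Everything is proved; no named facts are introduced.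

## References

* M. W. Hirsch, *Differential Topology*, GTM 33, Springer (1976), Ch. 8 §1, Thm. 1.3.
  [HirschDT1976]
-/

open scoped Manifold ContDiff Topology Real
open Function Set Metric Filter

noncomputable section

namespace Literature.Topology.FourManifolds

/-- Local notation: `𝔼 n` is the model Euclidean space `EuclideanSpace ℝ (Fin n)`. -/
local notation "𝔼 " n:arg => EuclideanSpace ℝ (Fin n)

/-- Local notation: `𝕊 n` is the unit sphere in `EuclideanSpace ℝ (Fin (n + 1))`. -/
local notation "𝕊 " n:arg => (Metric.sphere (0 : EuclideanSpace ℝ (Fin (n + 1))) 1)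

attribute [local instance] fact_finrank_euclideanSpace_succ

open ExitBend

namespace BandData

variable {A B K : Knot} {avoid : Set (𝕊 3)} {b : BandData A B K avoid}
variable {hcross : b.band ⁻¹' sphereEquator 2 ∩ squareNhd b.δ = {x | x ∈ squareNhd b.δ ∧ x 0 = 2⁻¹}}
variable {ε r A' κ lam₀ rA : ℝ}

namespace HostHyp

variable (P : b.HostHyp hcross ε r A' κ lam₀ rA)

/-! ### The retracted host off the moving interval is the necked rail loop -/

include P in
/-- With vanishing spike bump the spiked lower piece is the rail point. [folklore] -/
theorem pieceLo_one_eq_railLoPsi {α : ℝ} (hα : α ≤ 1 / 8) :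
    b.pieceLo hcross κ b.depthSign 1 α = b.railLoPsi κ α := by
  have hκ := P.HU.cone.spike.κ_pos
  have h := b.blowUp_pieceLo hcross hκ.ne' b.depthSign 1 α
  rw [spikeBump_eq_zero_of_le hα] at h
  simp only [mul_zero, sub_zero, one_smul, zero_smul, add_zero] at h
  have := congrArg (b.blowDown hcross κ) h
  rwa [b.blowDown_blowUp hcross hκ.ne', b.blowDown_blowUp hcross hκ.ne'] at this

include P in
/-- With vanishing spike bump the spiked upper piece is the rail point. [folklore] -/
theorem pieceHi_one_eq_railHiPsi {α : ℝ} (hα : α ≤ 1 / 8) :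
    b.pieceHi hcross κ b.depthSign 1 α = b.railHiPsi κ α := by
  have hκ := P.HU.cone.spike.κ_pos
  have h := b.blowUp_pieceHi hcross hκ.ne' b.depthSign 1 α
  rw [spikeBump_eq_zero_of_le hα] at h
  simp only [mul_zero, sub_zero, one_smul, zero_smul, add_zero] at h
  have := congrArg (b.blowDown hcross κ) h
  rwa [b.blowDown_blowUp hcross hκ.ne', b.blowDown_blowUp hcross hκ.ne'] at this

/-- **Left of `s₀` the instance wall frame is the necked rail loop.** [folklore] -/
theorem spikePiece_one_eq_neckPiece_of_lt_sLo {t : ℝ} (ht : t < P.sLo) :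
    b.spikePiece hcross κ b.depthSign 1 t = b.neckPiece κ 1 t := by
  have h := P.HU.cone.spike
  have hκ := h.κ_pos
  have hsl := P.sLo_spec
  have h8 := h.eight_lt_r
  by_cases hcore : b.tcLo - b.epsLo / 8 ≤ t
  · have htc : t ∈ Icc (b.tcLo - b.epsLo / 8) (b.tcLo + b.epsLo / 8) := ⟨hcore, by linarith [hsl.2.2]⟩
    have hαt : b.alphaLo κ t < 1 / 16 := by
      rw [← hsl.1]; exact b.strictMonoOn_alphaLo (κ := κ) hκ htc (P.paramLo_mem_core sixteenth_mem07) ht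
    by_cases hflat : κ * (|b.alphaLo κ t| + 1) < r
    · have hq := norm_railLoParam_lt hκ hflat
      rw [b.spikePiece_one_coreLo h htc hq, P.pieceLo_one_eq_railLoPsi (by linarith), ← b.neckPiece_eq_coreLo_flat h htc hq]
    · push Not at hflat
      have hα7 : b.alphaLo κ t ∉ Icc (-1 : ℝ) 6 := by
        intro hm
        have : |b.alphaLo κ t| ≤ 6 := by rw [abs_le]; constructor <;> linarith [hm.1, hm.2]
        have := mul_le_mul_of_nonneg_left this hκ.le
        linarith
      exact b.spikePiece_eq_neckPiece' h 1 (b.not_mem_spikeSet_of_coreLo htc hα7)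
  · push Not at hcore
    have hco := b.coreLo_lt_coreHi
    have hεL := b.epsLo_bounds.1; have hεH := b.epsHi_bounds.1
    refine b.spikePiece_eq_neckPiece' h 1 ?_
    rintro (⟨hc, -⟩ | ⟨hc, -⟩)
    · linarith [hc.1]
    · linarith [hc.1]

/-- **Right of `s₀'` the instance wall frame is the necked rail loop.** [folklore] -/
theorem spikePiece_one_eq_neckPiece_of_sHi_lt {t : ℝ} (ht : P.sHi < t) :
    b.spikePiece hcross κ b.depthSign 1 t = b.neckPiece κ 1 t := by
  have h := P.HU.cone.spike
  have hκ := h.κ_pos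
  have hsh := P.sHi_spec
  have h8 := h.eight_lt_r
  by_cases hcore : t ≤ b.tcHi + b.epsHi / 8
  · have htc : t ∈ Icc (b.tcHi - b.epsHi / 8) (b.tcHi + b.epsHi / 8) := ⟨by linarith [hsh.2.1], hcore⟩
    have hαt : b.alphaHi κ t < 1 / 16 := by
      rw [← hsh.1]; exact b.strictAntiOn_alphaHi (κ := κ) hκ (P.paramHi_mem_core sixteenth_mem07) htc ht
    by_cases hflat : κ * (|b.alphaHi κ t| + 1) < r
    · have hq := norm_railHiParam_lt hκ hflat
      rw [b.spikePiece_one_coreHi h htc hq, P.pieceHi_one_eq_railHiPsi (by linarith), ← b.neckPiece_eq_coreHi_flat h htc hq]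
    · push Not at hflat
      have hα7 : b.alphaHi κ t ∉ Icc (-1 : ℝ) 6 := by
        intro hm
        have : |b.alphaHi κ t| ≤ 6 := by rw [abs_le]; constructor <;> linarith [hm.1, hm.2]
        have := mul_le_mul_of_nonneg_left this hκ.le
        linarith
      exact b.spikePiece_eq_neckPiece' h 1 (b.not_mem_spikeSet_of_coreHi htc hα7)
  · push Not at hcore
    have hco := b.coreLo_lt_coreHi
    have hεL := b.epsLo_bounds.1; have hεH := b.epsHi_bounds.1
    refine b.spikePiece_eq_neckPiece' h 1 ?_
    rintro (⟨hc, -⟩ | ⟨hc, -⟩)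
    · linarith [hc.2]
    · linarith [hc.2]

/-- **The host off the moving interval is the necked rail loop** (on the fundamental domain).
[folklore] -/
theorem coe_host_circlePt_of_not_mem {t : ℝ} (htI : t ∈ Ico b.alo (b.alo + 1)) (hts : t ∉ Icc P.sLo P.sHi) :
    ((P.host (circlePt t) : 𝕊 3) : 𝔼 4) = b.neckPiece κ 1 t := by
  rcases lt_or_ge t P.sLo with hlt | hge
  · rw [show P.host (circlePt t) = P.hostPt t from rfl, P.coe_hostPt_of_lt_sLo htI hlt, P.spikePiece_one_eq_neckPiece_of_lt_sLo hlt]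
  · have hgt : P.sHi < t := by
      by_contra hc; push Not at hc; exact hts ⟨hge, hc⟩
    rw [show P.host (circlePt t) = P.hostPt t from rfl, P.coe_hostPt_of_sHi_lt htI hgt, P.spikePiece_one_eq_neckPiece_of_sHi_lt hgt]

/-! ### The clean height profiles and the cleaning family -/

/-- The blend step of the lower plateau arch: `0` for `t ≤ alo + 3ε/2`, `1` for `t ≥ alo + 2ε`.
[folklore] -/
def aLo (_ : b.HostHyp hcross ε r A' κ lam₀ rA) (t : ℝ) : ℝ := smoothStep (b.alo + 3 / 2 * b.epsLo) (b.alo + 2 * b.epsLo) t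

/-- The blend step of the upper plateau arch (in the reversed parameter): `1` for `t ≤ ahi - 2ε'`,
`0` for `t ≥ ahi - 3ε'/2`. [folklore] -/
def aUp (_ : b.HostHyp hcross ε r A' κ lam₀ rA) (t : ℝ) : ℝ :=
  smoothStep (-b.ahi + 3 / 2 * b.epsHi) (-b.ahi + 2 * b.epsHi) (-t)

/-- **The clean lower height**: straight from the edge height `fLo` to the neck height `1/2 - κ`.
[folklore] -/
def cleanLo (t : ℝ) : ℝ := (1 - P.aLo t) * b.fLo t + P.aLo t * (1 / 2 - κ)

/-- **The clean upper height**: from the neck height `1/2 + κ` to the edge height `fUp`. [folklore] -/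
def cleanUp (t : ℝ) : ℝ := (1 - P.aUp t) * b.fUp t + P.aUp t * (1 / 2 + κ)

/-- **The lower cleaning family**: same first coordinate as the rail arch, height on the segment
from the necked height to the clean height. [folklore] -/
def famLo (u t : ℝ) : 𝔼 2 := pt2 (b.railLo t 0) ((1 - u) * b.neckLo κ 1 t 1 + u * P.cleanLo t)

/-- **The upper cleaning family.** [folklore] -/
def famUp (u t : ℝ) : 𝔼 2 := pt2 (b.railUp t 0) ((1 - u) * b.neckUp κ 1 t 1 + u * P.cleanUp t)

/-- **The planar path of the retracted host on the moving interval.** [folklore] -/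
def qS (t : ℝ) : 𝔼 2 := pt2 2⁻¹ 2⁻¹ + κ • P.hh t

/-- **The cleaning family** on the whole band window. [folklore] -/
def cfam (u t : ℝ) : 𝔼 2 := if t < P.sLo then P.famLo u t else if t ≤ P.sHi then P.qS t else P.famUp u t

/-! ### Formulas -/

/-- The blend steps take values in `[0, 1]`. [folklore] -/
theorem aLo_mem (t : ℝ) : P.aLo t ∈ Icc (0 : ℝ) 1 := smoothStep_mem_Icc _ _ _

/-- The blend steps take values in `[0, 1]`. [folklore] -/
theorem aUp_mem (t : ℝ) : P.aUp t ∈ Icc (0 : ℝ) 1 := smoothStep_mem_Icc _ _ _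

/-- `aLo = 0` left of `alo + 3ε/2`. [folklore] -/
theorem aLo_of_le {t : ℝ} (ht : t ≤ b.alo + 3 / 2 * b.epsLo) : P.aLo t = 0 :=
  smoothStep_of_le (by linarith [b.epsLo_bounds.1]) ht

/-- `aLo = 1` right of `alo + 2ε`. [folklore] -/
theorem aLo_of_ge {t : ℝ} (ht : b.alo + 2 * b.epsLo ≤ t) : P.aLo t = 1 :=
  smoothStep_of_ge (by linarith [b.epsLo_bounds.1]) ht

/-- `aUp = 0` right of `ahi - 3ε'/2`. [folklore] -/
theorem aUp_of_ge {t : ℝ} (ht : b.ahi - 3 / 2 * b.epsHi ≤ t) : P.aUp t = 0 :=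
  smoothStep_of_le (by linarith [b.epsHi_bounds.1]) (by linarith)

/-- `aUp = 1` left of `ahi - 2ε'`. [folklore] -/
theorem aUp_of_le {t : ℝ} (ht : t ≤ b.ahi - 2 * b.epsHi) : P.aUp t = 1 :=
  smoothStep_of_ge (by linarith [b.epsHi_bounds.1]) (by linarith)

/-- **The height of the lower rail arch left of `tlo - 2ε`**: `(1 - aLo) fLo + aLo / 4`. [folklore] -/
theorem railLo_one_eq {t : ℝ} (ht : t ≤ b.tlo - 2 * b.epsLo) :
    b.railLo t 1 = (1 - P.aLo t) * b.fLo t + P.aLo t * (1 / 4) := by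
  have hε := b.epsLo_bounds.1
  rw [railLo, plateauArch_apply_one, plateauHeight,
    smoothStep_of_le (show b.tlo - 2 * b.epsLo < b.tlo - 3 / 2 * b.epsLo by linarith) ht]
  simp [aLo]

/-- **The height of the upper rail arch right of `thi + 2ε'`**: `(1 - aUp) fUp + (3/4) aUp`. [folklore] -/
theorem railUp_one_eq {t : ℝ} (ht : b.thi + 2 * b.epsHi ≤ t) :
    b.railUp t 1 = (1 - P.aUp t) * b.fUp t + P.aUp t * (3 / 4) := by
  have hε := b.epsHi_bounds.1
  rw [railUp_apply_one, railUpAux, plateauArch_apply_one, plateauHeight,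
    smoothStep_of_le (show -b.thi - 2 * b.epsHi < -b.thi - 3 / 2 * b.epsHi by linarith) (by linarith)]
  simp [aUp]; ring

/-- The first coordinate of the lower rail arch is `χ₁`. [folklore] -/
theorem railLo_zero_eq_chiLo (t : ℝ) : b.railLo t 0 = b.chiLo t := rfl

/-- The first coordinate of the upper rail arch is `chiHi`. [folklore] -/
theorem railUp_zero_eq_chiHi (t : ℝ) : b.railUp t 0 = b.chiHi t := rfl

/-- Coordinates of the lower family. [folklore] -/
@[simp] theorem famLo_apply_zero (u t : ℝ) : P.famLo u t 0 = b.railLo t 0 := rfl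

/-- Coordinates of the lower family. [folklore] -/
@[simp] theorem famLo_apply_one (u t : ℝ) : P.famLo u t 1 = (1 - u) * b.neckLo κ 1 t 1 + u * P.cleanLo t := rfl

/-- Coordinates of the upper family. [folklore] -/
@[simp] theorem famUp_apply_zero (u t : ℝ) : P.famUp u t 0 = b.railUp t 0 := rfl

/-- Coordinates of the upper family. [folklore] -/
@[simp] theorem famUp_apply_one (u t : ℝ) : P.famUp u t 1 = (1 - u) * b.neckUp κ 1 t 1 + u * P.cleanUp t := rfl

/-- Coordinates of the middle path. [folklore] -/
@[simp] theorem qS_apply_zero (t : ℝ) : P.qS t 0 = 1 / 2 + κ * P.hh t 0 := by simp [qS]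

/-- Coordinates of the middle path. [folklore] -/
@[simp] theorem qS_apply_one (t : ℝ) : P.qS t 1 = 1 / 2 + κ * P.hh t 1 := by simp [qS]

/-- **Left of `alo + 3ε/2` the lower family is the rail arch** (for every `u`). [folklore] -/
theorem famLo_of_le {u t : ℝ} (ht : t ≤ b.alo + 3 / 2 * b.epsLo) : P.famLo u t = b.railLo t := by
  obtain ⟨h1, h2, hε⟩ := b.tcLo_window
  have hrl := P.railLo_one_eq (t := t) (by linarith)
  have hn : b.neckLo κ 1 t 1 = b.railLo t 1 := by
    rw [b.neckLo_eq_railLo (fun hm ↦ by linarith [hm.1])]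
  have e1 : P.famLo u t 1 = b.railLo t 1 := by
    rw [famLo_apply_one, hn, hrl, cleanLo, P.aLo_of_le ht]; ring
  ext i; fin_cases i
  · rfl
  · exact e1

/-- **Right of `ahi - 3ε'/2` the upper family is the rail arch.** [folklore] -/
theorem famUp_of_ge {u t : ℝ} (ht : b.ahi - 3 / 2 * b.epsHi ≤ t) : P.famUp u t = b.railUp t := by
  obtain ⟨h1, h2, hε⟩ := b.tcHi_window
  have hrl := P.railUp_one_eq (t := t) (by linarith)
  have hn : b.neckUp κ 1 t 1 = b.railUp t 1 := by
    rw [b.neckUp_eq_railUp (fun hm ↦ by linarith [hm.2])]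
  have e1 : P.famUp u t 1 = b.railUp t 1 := by
    rw [famUp_apply_one, hn, hrl, cleanUp, P.aUp_of_ge ht]; ring
  ext i; fin_cases i
  · rfl
  · exact e1

/-- **On the lower core the lower family is `(χ₁ t, 1/2 - κ)`** (for every `u`). [folklore] -/
theorem famLo_of_mem_core {u t : ℝ} (ht : t ∈ Icc (b.tcLo - b.epsLo / 8) (b.tcLo + b.epsLo / 8)) :
    P.famLo u t = pt2 (b.chiLo t) (1 / 2 - κ) := by
  obtain ⟨h1, h2, hε⟩ := b.tcLo_window
  have hn : b.neckLo κ 1 t 1 = 1 / 2 - κ := by rw [b.neckLo_of_mem_core ht, pt2_apply_one]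
  have hc : P.cleanLo t = 1 / 2 - κ := by rw [cleanLo, P.aLo_of_ge (by linarith [ht.1])]; ring
  have e1 : P.famLo u t 1 = 1 / 2 - κ := by rw [famLo_apply_one, hn, hc]; ring
  ext i; fin_cases i
  · rfl
  · exact e1

/-- **On the upper core the upper family is `(chiHi t, 1/2 + κ)`.** [folklore] -/
theorem famUp_of_mem_core {u t : ℝ} (ht : t ∈ Icc (b.tcHi - b.epsHi / 8) (b.tcHi + b.epsHi / 8)) :
    P.famUp u t = pt2 (b.chiHi t) (1 / 2 + κ) := by
  obtain ⟨h1, h2, hε⟩ := b.tcHi_window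
  have hn : b.neckUp κ 1 t 1 = 1 / 2 + κ := by rw [b.neckUp_of_mem_core ht, pt2_apply_one]
  have hc : P.cleanUp t = 1 / 2 + κ := by rw [cleanUp, P.aUp_of_le (by linarith [ht.2])]; ring
  have e1 : P.famUp u t 1 = 1 / 2 + κ := by rw [famUp_apply_one, hn, hc]; ring
  ext i; fin_cases i
  · rfl
  · exact e1

/-- **On the lower core with `αLo ≤ 1/4 + 1/48` the middle path is `(χ₁ t, 1/2 - κ)`.** [folklore] -/
theorem qS_of_alphaLo_le {t : ℝ} (ht : t ≤ b.tcLo + b.epsLo / 8) (hα : b.alphaLo κ t ≤ 1 / 4 + 1 / 48) :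
    P.qS t = pt2 (b.chiLo t) (1 / 2 - κ) := by
  have hκ := P.HU.cone.spike.κ_pos
  have hm := b.mul_alphaLo hκ.ne' t
  have e0 : P.qS t 0 = b.chiLo t := by rw [qS_apply_zero, P.hh_of_alphaLo_le ht hα, pt2_apply_zero]; linarith
  have e1 : P.qS t 1 = 1 / 2 - κ := by rw [qS_apply_one, P.hh_of_alphaLo_le ht hα, pt2_apply_one]; ring
  ext i; fin_cases i
  · exact e0
  · exact e1

/-- **On the upper core with `αHi ≤ 1/4 + 1/48` the middle path is `(chiHi t, 1/2 + κ)`.** [folklore] -/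
theorem qS_of_alphaHi_le {t : ℝ} (ht : b.tcHi - b.epsHi / 8 ≤ t) (hα : b.alphaHi κ t ≤ 1 / 4 + 1 / 48) :
    P.qS t = pt2 (b.chiHi t) (1 / 2 + κ) := by
  have hκ := P.HU.cone.spike.κ_pos
  have hm := b.mul_alphaHi hκ.ne' t
  have e0 : P.qS t 0 = b.chiHi t := by rw [qS_apply_zero, P.hh_of_alphaHi_le ht hα, pt2_apply_zero]; linarith
  have e1 : P.qS t 1 = 1 / 2 + κ := by rw [qS_apply_one, P.hh_of_alphaHi_le ht hα, pt2_apply_one]; ring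
  ext i; fin_cases i
  · exact e0
  · exact e1

/-- **The cleaning family left of `paramLo (1/4)` is the lower family.** [folklore] -/
theorem cfam_of_lt_quarterLo {u t : ℝ} (ht : t < P.paramLo quarter_mem07) : P.cfam u t = P.famLo u t := by
  by_cases h1 : t < P.sLo
  · simp [cfam, h1]
  · push Not at h1
    have hq := P.paramLo_spec quarter_mem07; have hqc := P.paramLo_mem_core quarter_mem07
    have htc : t ∈ Icc (b.tcLo - b.epsLo / 8) (b.tcLo + b.epsLo / 8) := ⟨by linarith [P.sLo_spec.2.1, b.epsLo_bounds.1], by linarith [hqc.2]⟩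
    have hα : b.alphaLo κ t ≤ 1 / 4 := by
      rw [← hq.2]; exact (b.strictMonoOn_alphaLo (κ := κ) P.HU.cone.spike.κ_pos).monotoneOn htc hqc ht.le
    have h2 : t ≤ P.sHi := by linarith [P.marks.2.1, hqc.2, P.zone_marks.2.2.1, P.zone_marks.2.2.2.1, P.zone_marks.2.2.2.2.1,
      P.zone_marks.2.2.2.2.2, b.coreLo_lt_coreHi]
    simp only [cfam, not_lt.2 h1, if_false, h2, if_true]
    rw [P.qS_of_alphaLo_le htc.2 (by linarith), P.famLo_of_mem_core htc]

/-- **The cleaning family right of `paramHi (1/4)` is the upper family.** [folklore] -/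
theorem cfam_of_quarterHi_lt {u t : ℝ} (ht : P.paramHi quarter_mem07 < t) : P.cfam u t = P.famUp u t := by
  have hq := P.paramHi_spec quarter_mem07; have hqc := P.paramHi_mem_core quarter_mem07
  have h1 : ¬ t < P.sLo := by
    push Not
    linarith [P.marks.2.1, hqc.1, P.zone_marks.1, P.zone_marks.2.1, P.zone_marks.2.2.1, P.zone_marks.2.2.2.1, b.coreLo_lt_coreHi]
  by_cases h2 : t ≤ P.sHi
  · have htc : t ∈ Icc (b.tcHi - b.epsHi / 8) (b.tcHi + b.epsHi / 8) := ⟨by linarith [hqc.1], by linarith [P.sHi_spec.2.2, b.epsHi_bounds.1]⟩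
    have hα : b.alphaHi κ t ≤ 1 / 4 := by
      rw [← hq.2]; exact (b.strictAntiOn_alphaHi (κ := κ) P.HU.cone.spike.κ_pos).antitoneOn hqc htc ht.le
    simp only [cfam, h1, if_false, h2, if_true]
    rw [P.qS_of_alphaHi_le htc.1 (by linarith), P.famUp_of_mem_core htc]
  · simp [cfam, h1, h2]

/-- **The cleaning family on `(paramLo 0, paramHi 0)` is the middle path.** [folklore] -/
theorem cfam_of_mem_region {u t : ℝ} (ht : t ∈ Ioo (P.paramLo zero_mem07) (P.paramHi zero_mem07)) : P.cfam u t = P.qS t := by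
  have h0 := P.paramLo_spec zero_mem07; have h0c := P.paramLo_mem_core zero_mem07
  have h0' := P.paramHi_spec zero_mem07; have h0c' := P.paramHi_mem_core zero_mem07
  by_cases h1 : t < P.sLo
  · have htc : t ∈ Icc (b.tcLo - b.epsLo / 8) (b.tcLo + b.epsLo / 8) := ⟨by linarith [h0c.1, ht.1], by linarith [P.sLo_spec.2.2]⟩
    have hα : b.alphaLo κ t ≤ 1 / 16 := by
      rw [← P.sLo_spec.1]; exact (b.strictMonoOn_alphaLo (κ := κ) P.HU.cone.spike.κ_pos).monotoneOn htc (P.paramLo_mem_core _) h1.le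
    simp only [cfam, h1, if_true]
    rw [P.famLo_of_mem_core htc, P.qS_of_alphaLo_le htc.2 (by linarith)]
  by_cases h2 : t ≤ P.sHi
  · simp [cfam, h1, h2]
  · push Not at h1 h2
    have htc : t ∈ Icc (b.tcHi - b.epsHi / 8) (b.tcHi + b.epsHi / 8) := ⟨by linarith [P.sHi_spec.2.1], by linarith [h0c'.2, ht.2]⟩
    have hα : b.alphaHi κ t ≤ 1 / 16 := by
      rw [← P.sHi_spec.1]; exact (b.strictAntiOn_alphaHi (κ := κ) P.HU.cone.spike.κ_pos).antitoneOn (P.paramHi_mem_core _) htc h2.le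
    simp only [cfam, not_lt.2 h1, if_false, not_le.2 h2]
    rw [P.famUp_of_mem_core htc, P.qS_of_alphaHi_le htc.1 (by linarith)]

/-- On the moving interval the cleaning family is the middle path. [folklore] -/
theorem cfam_of_mem_S {u t : ℝ} (ht : t ∈ Icc P.sLo P.sHi) : P.cfam u t = P.qS t := by
  simp [cfam, not_lt.2 ht.1, ht.2]

/-! ### Smoothness -/

/-- The lower family is jointly `C^∞`. [folklore] -/
theorem contDiff_famLo : ContDiff ℝ ∞ (uncurry P.famLo) := by
  have hx : ContDiff ℝ ∞ fun p : ℝ × ℝ ↦ b.railLo p.2 0 := (contDiff_euclidean.1 b.contDiff_railLo 0).comp contDiff_snd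
  have hn : ContDiff ℝ ∞ fun p : ℝ × ℝ ↦ b.neckLo κ 1 p.2 1 := (contDiff_euclidean.1 (b.contDiff_neckLo_stage κ 1) 1).comp contDiff_snd
  have ha : ContDiff ℝ ∞ P.aLo := contDiff_smoothStep _ _
  have hc : ContDiff ℝ ∞ fun p : ℝ × ℝ ↦ P.cleanLo p.2 :=
    (((contDiff_const.sub ha).mul b.fLo_spec.1).add (ha.mul contDiff_const)).comp contDiff_snd
  have e : uncurry P.famLo = fun p : ℝ × ℝ ↦ pt2 (b.railLo p.2 0) ((1 - p.1) * b.neckLo κ 1 p.2 1 + p.1 * P.cleanLo p.2) := by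
    funext ⟨u, t⟩; rfl
  rw [e, contDiff_euclidean]
  intro i; fin_cases i
  · exact hx
  · exact ((contDiff_const.sub contDiff_fst).mul hn).add (contDiff_fst.mul hc)

/-- The upper family is jointly `C^∞`. [folklore] -/
theorem contDiff_famUp : ContDiff ℝ ∞ (uncurry P.famUp) := by
  have hx : ContDiff ℝ ∞ fun p : ℝ × ℝ ↦ b.railUp p.2 0 := (contDiff_euclidean.1 b.contDiff_railUp 0).comp contDiff_snd
  have hn : ContDiff ℝ ∞ fun p : ℝ × ℝ ↦ b.neckUp κ 1 p.2 1 := (contDiff_euclidean.1 (b.contDiff_neckUp_stage κ 1) 1).comp contDiff_snd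
  have ha : ContDiff ℝ ∞ P.aUp := (contDiff_smoothStep _ _).comp contDiff_neg
  have hc : ContDiff ℝ ∞ fun p : ℝ × ℝ ↦ P.cleanUp p.2 :=
    (((contDiff_const.sub ha).mul b.fUp_spec.1).add (ha.mul contDiff_const)).comp contDiff_snd
  have e : uncurry P.famUp = fun p : ℝ × ℝ ↦ pt2 (b.railUp p.2 0) ((1 - p.1) * b.neckUp κ 1 p.2 1 + p.1 * P.cleanUp p.2) := by
    funext ⟨u, t⟩; rfl
  rw [e, contDiff_euclidean]
  intro i; fin_cases i
  · exact hx
  · exact ((contDiff_const.sub contDiff_fst).mul hn).add (contDiff_fst.mul hc)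

/-- The middle path is `C^∞` on the region. [folklore] -/
theorem contDiffAt_qS {t : ℝ} (ht : t ∈ Icc (P.paramLo zero_mem07) (P.paramHi zero_mem07)) : ContDiffAt ℝ ∞ P.qS t :=
  contDiffAt_const.add ((P.contDiffAt_hh ht).const_smul κ)

/-- **The cleaning family is jointly `C^∞`.** [folklore] -/
theorem contDiff_cfam : ContDiff ℝ ∞ (uncurry P.cfam) := by
  have hq := P.paramLo_spec quarter_mem07; have hq' := P.paramHi_spec quarter_mem07
  have h0 := P.paramLo_spec zero_mem07; have h0' := P.paramHi_spec zero_mem07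
  have hlt : P.paramLo zero_mem07 < P.paramLo quarter_mem07 := by
    rw [← P.alphaLo_lt_iff quarter_mem07 (P.paramLo_mem_core zero_mem07), h0.2]; norm_num
  have hlt' : P.paramHi quarter_mem07 < P.paramHi zero_mem07 := by
    rw [← P.alphaHi_lt_iff quarter_mem07 (P.paramHi_mem_core zero_mem07), h0'.2]; norm_num
  rw [contDiff_iff_contDiffAt]
  rintro ⟨u, t⟩
  by_cases h1 : t < P.paramLo quarter_mem07
  · have hev : uncurry P.cfam =ᶠ[𝓝 (u, t)] uncurry P.famLo := by
      have ho : IsOpen {p : ℝ × ℝ | p.2 < P.paramLo quarter_mem07} := isOpen_Iio.preimage continuous_snd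
      filter_upwards [ho.mem_nhds (show (u, t) ∈ {p : ℝ × ℝ | p.2 < P.paramLo quarter_mem07} from h1)] with p hp
      exact P.cfam_of_lt_quarterLo hp
    exact (P.contDiff_famLo.contDiffAt).congr_of_eventuallyEq hev
  by_cases h2 : P.paramHi quarter_mem07 < t
  · have hev : uncurry P.cfam =ᶠ[𝓝 (u, t)] uncurry P.famUp := by
      have ho : IsOpen {p : ℝ × ℝ | P.paramHi quarter_mem07 < p.2} := isOpen_Ioi.preimage continuous_snd
      filter_upwards [ho.mem_nhds (show (u, t) ∈ {p : ℝ × ℝ | P.paramHi quarter_mem07 < p.2} from h2)] with p hp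
      exact P.cfam_of_quarterHi_lt hp
    exact (P.contDiff_famUp.contDiffAt).congr_of_eventuallyEq hev
  push Not at h1 h2
  have hmem : t ∈ Ioo (P.paramLo zero_mem07) (P.paramHi zero_mem07) := ⟨by linarith, by linarith⟩
  have hev : uncurry P.cfam =ᶠ[𝓝 (u, t)] fun p : ℝ × ℝ ↦ P.qS p.2 := by
    have ho : IsOpen {p : ℝ × ℝ | p.2 ∈ Ioo (P.paramLo zero_mem07) (P.paramHi zero_mem07)} := isOpen_Ioo.preimage continuous_snd
    filter_upwards [ho.mem_nhds (show (u, t) ∈ {p : ℝ × ℝ | p.2 ∈ Ioo (P.paramLo zero_mem07) (P.paramHi zero_mem07)} from hmem)]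
      with p hp
    exact P.cfam_of_mem_region hp
  refine ContDiffAt.congr_of_eventuallyEq ?_ hev
  have : ContDiffAt ℝ ∞ (P.qS ∘ Prod.snd) (u, t) := (P.contDiffAt_qS (Ioo_subset_Icc_self hmem)).comp (u, t) contDiffAt_snd
  exact this

/-! ### Where the moving interval sits in the band window -/

/-- Order of the marks: `θ(1/10) < θ(3/20) < alo < alo + 2ε ≤ tcLo - ε/2 < s₀` and
`s₀' < tcHi + ε'/2 ≤ ahi - 2ε' < ahi < θ(17/20) < θ(9/10)`. [folklore] -/
theorem band_marks : b.thetaA 10⁻¹ < b.thetaA (3 / 20) ∧ b.thetaA (3 / 20) < b.alo ∧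
    b.alo + 2 * b.epsLo ≤ b.tcLo - b.epsLo / 2 ∧ b.tcLo - b.epsLo / 2 < P.sLo ∧ P.sLo < P.sHi ∧
    P.sHi < b.tcHi + b.epsHi / 2 ∧ b.tcHi + b.epsHi / 2 ≤ b.ahi - 2 * b.epsHi ∧ b.ahi < b.thetaA (17 / 20) ∧
    b.thetaA (17 / 20) < b.thetaA (9 / 10) ∧ 0 < b.epsLo ∧ 0 < b.epsHi ∧ b.tcLo + b.epsLo / 2 ≤ b.tlo - 2 * b.epsLo ∧
    b.thi + 2 * b.epsHi ≤ b.tcHi - b.epsHi / 2 := by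
  have hm := b.marks_lt
  obtain ⟨h1, h2, hε⟩ := b.tcLo_window
  obtain ⟨h3, h4, hε'⟩ := b.tcHi_window
  have hsl := P.sLo_spec; have hsh := P.sHi_spec
  refine ⟨hm.1, hm.2.1, h1, by linarith [hsl.2.1], P.marks.2.1, by linarith [hsh.2.2], h4, hm.2.2.2.2.2.1, hm.2.2.2.2.2.2.1, hε, hε', h2, h3⟩

/-- On the moving interval the first coordinate of the target is at least `1/16`. [folklore] -/
theorem hh_zero_ge {s : ℝ} (hs : s ∈ Icc P.sLo P.sHi) : 1 / 16 ≤ P.hh s 0 := by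
  have hε := epsP_pos
  rcases P.hh_cases hs with ⟨-, hα, e⟩ | ⟨-, hα, e⟩ | ⟨-, -, e, hμ⟩
  · rw [e, pt2_apply_zero]; exact hα.1
  · rw [e, pt2_apply_zero]; exact hα.1
  · obtain ⟨ht0, -⟩ := tgt_mem (m := P.mu s) ⟨by linarith [hμ.1], by linarith [hμ.2]⟩
    rw [e]; linarith [ht0.1]

/-- On the moving interval `|hh₁| ≤ 1` and `hh₀ ≤ 5/4`. [folklore] -/
theorem hh_bounds {s : ℝ} (hs : s ∈ Icc P.sLo P.sHi) : |P.hh s 1| ≤ 1 ∧ P.hh s 0 ≤ 5 / 4 := by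
  have hε := epsP_pos
  rcases P.hh_cases hs with ⟨-, hα, e⟩ | ⟨-, hα, e⟩ | ⟨-, -, e, hμ⟩
  · rw [e, pt2_apply_one, pt2_apply_zero]
    exact ⟨abs_gLoT_le ⟨by linarith [hα.1], hα.2⟩, by linarith [hα.2]⟩
  · rw [e, pt2_apply_one, pt2_apply_zero]
    exact ⟨abs_gHiT_le ⟨by linarith [hα.1], hα.2⟩, by linarith [hα.2]⟩
  · obtain ⟨ht0, ht1⟩ := tgt_mem (m := P.mu s) ⟨by linarith [hμ.1], by linarith [hμ.2]⟩
    rw [e]; exact ⟨abs_le.2 ⟨ht1.1, ht1.2⟩, ht0.2⟩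

/-- **First coordinates**: left of `s₀` the rail arch has `χ₁ < 1/2 + κ/16`. [folklore] -/
theorem railLo_zero_lt_of_lt_sLo {s : ℝ} (hs : s < P.sLo) : b.railLo s 0 < 1 / 2 + κ / 16 := by
  have hκ := P.HU.cone.spike.κ_pos
  have hsl := P.sLo_spec
  have hbm := P.band_marks
  have hx : b.chiLo P.sLo = 1 / 2 + κ / 16 := by
    have := b.mul_alphaLo hκ.ne' P.sLo; rw [hsl.1] at this; linarith
  rw [railLo_zero_eq_chiLo, ← hx]
  have hmono : Monotone b.chiLo := monotone_smoothStep (by linarith [b.cLo_hyp.1, b.cLo_hyp.2.1])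
  rcases le_or_gt s (b.alo + b.epsLo) with h1 | h1
  · have h0 : b.chiLo s = 0 := smoothStep_of_le (by linarith [b.cLo_hyp.1, b.cLo_hyp.2.1]) h1
    rw [h0, hx]; positivity
  · have hsI : P.sLo ∈ Icc (b.alo + b.epsLo) (b.tlo - b.epsLo) := ⟨by linarith [hsl.2.1], by linarith [hsl.2.2]⟩
    exact b.strictMonoOn_railLo_zero ⟨h1.le, by linarith [hsI.2]⟩ hsI hs

/-- **First coordinates**: right of `s₀'` the upper rail arch has `chiHi < 1/2 + κ/16`. [folklore] -/
theorem railUp_zero_lt_of_sHi_lt {s : ℝ} (hs : P.sHi < s) : b.railUp s 0 < 1 / 2 + κ / 16 := by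
  have hκ := P.HU.cone.spike.κ_pos
  have hsh := P.sHi_spec
  have hbm := P.band_marks
  have hx : b.chiHi P.sHi = 1 / 2 + κ / 16 := by
    have := b.mul_alphaHi hκ.ne' P.sHi; rw [hsh.1] at this; linarith
  rw [railUp_zero_eq_chiHi, ← hx]
  rcases le_or_gt (b.ahi - b.epsHi) s with h1 | h1
  · have h0 : b.chiHi s = 0 := smoothStep_of_le (by linarith [b.cUp_hyp.1, b.cUp_hyp.2.1]) (by linarith)
    rw [h0, hx]; positivity
  · have hsI : P.sHi ∈ Icc (b.thi + b.epsHi) (b.ahi - b.epsHi) := ⟨by linarith [hsh.2.1], by linarith [hsh.2.2]⟩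
    exact b.strictAntiOn_railUp_zero hsI ⟨by linarith [hsI.1], h1.le⟩ hs

/-- **First coordinates on the moving interval**: `1/2 + κ/16 ≤ qS₀ ≤ 1/2 + 2κ`. [folklore] -/
theorem qS_zero_mem {s : ℝ} (hs : s ∈ Icc P.sLo P.sHi) : P.qS s 0 ∈ Icc (1 / 2 + κ / 16) (1 / 2 + 2 * κ) := by
  have hκ := P.HU.cone.spike.κ_pos
  have h1 := P.hh_zero_ge hs; have h2 := (P.hh_bounds hs).2
  rw [qS_apply_zero]; constructor <;> nlinarith

/-- **Heights of the lower family**: in `(1/10, 1/2 - κ]`. [folklore] -/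
theorem famLo_one_mem {u : ℝ} (hu : u ∈ Icc (0 : ℝ) 1) {s : ℝ} (hs : s ∈ Ico b.alo P.sLo) :
    P.famLo u s 1 ∈ Ioc (10⁻¹ : ℝ) (1 / 2 - κ) := by
  have hκ := P.HU.cone.spike.κ_pos
  have hκ12 := P.HU.cone.spike.κ_le
  have hbm := P.band_marks
  have hsl := P.sLo_spec
  have hst : s ∈ Icc b.alo b.tlo := ⟨hs.1, by linarith [hs.2, hsl.2.2]⟩
  obtain ⟨-, hr⟩ := b.railLo_mem hst
  obtain ⟨hf, hfm⟩ := b.fLo_eq_heightA ⟨by linarith [hs.1], hst.2⟩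
  have ha := P.aLo_mem s
  -- the necked height
  have hn : b.neckLo κ 1 s 1 ∈ Ioc (10⁻¹ : ℝ) (1 / 2 - κ) := by
    by_cases hw : s ∈ Icc (b.tcLo - b.epsLo / 2) (b.tcLo + b.epsLo / 2)
    · have := b.neckLo_one_mem (w := κ) (by linarith) ⟨zero_le_one, le_rfl⟩ hw
      exact ⟨by linarith [this.1], this.2⟩
    · rw [b.neckLo_eq_railLo (fun hm ↦ hw ⟨by linarith [hm.1], by linarith [hm.2]⟩)]
      exact ⟨hr.1, by linarith [hr.2]⟩
  -- the clean height
  have hc : P.cleanLo s ∈ Ioc (10⁻¹ : ℝ) (1 / 2 - κ) := by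
    rw [cleanLo, hf]
    constructor
    · nlinarith [ha.1, ha.2, hfm.1]
    · nlinarith [ha.1, ha.2, hfm.2]
  rw [famLo_apply_one]
  exact ⟨lt_of_lt_of_le (lt_min hn.1 hc.1) (min_le_convexComb hu), cvx_le hu hn.2 hc.2⟩

/-- **Heights of the upper family**: in `[1/2 + κ, 9/10)`. [folklore] -/
theorem famUp_one_mem {u : ℝ} (hu : u ∈ Icc (0 : ℝ) 1) {s : ℝ} (hs : s ∈ Ioc P.sHi b.ahi) :
    P.famUp u s 1 ∈ Ico (1 / 2 + κ : ℝ) (9 / 10) := by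
  have hκ := P.HU.cone.spike.κ_pos
  have hκ12 := P.HU.cone.spike.κ_le
  have hbm := P.band_marks
  have hsh := P.sHi_spec
  have hst : s ∈ Icc b.thi b.ahi := ⟨by linarith [hs.1, hsh.2.1], hs.2⟩
  obtain ⟨-, hr⟩ := b.railUp_mem hst
  obtain ⟨hf, hfm⟩ := b.fUp_eq_heightA ⟨hst.1, by linarith [hs.2]⟩
  have ha := P.aUp_mem s
  have hn : b.neckUp κ 1 s 1 ∈ Ico (1 / 2 + κ : ℝ) (9 / 10) := by
    by_cases hw : s ∈ Icc (b.tcHi - b.epsHi / 2) (b.tcHi + b.epsHi / 2)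
    · have := b.neckUp_one_mem (w := κ) (by linarith) ⟨zero_le_one, le_rfl⟩ hw
      exact ⟨this.1, by linarith [this.2]⟩
    · rw [b.neckUp_eq_railUp (fun hm ↦ hw ⟨by linarith [hm.1], by linarith [hm.2]⟩)]
      exact ⟨by linarith [hr.1], hr.2⟩
  have hc : P.cleanUp s ∈ Ico (1 / 2 + κ : ℝ) (9 / 10) := by
    rw [cleanUp, hf]
    constructor
    · nlinarith [ha.1, ha.2, hfm.1]
    · nlinarith [ha.1, ha.2, hfm.2]
  rw [famUp_apply_one]
  exact ⟨cvx_ge hu hn.1 hc.1, lt_of_le_of_lt (convexComb_le_max hu) (max_lt hn.2 hc.2)⟩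

/-- **The retracted host off `[alo, ahi]` (in the base domain) is `A`.** [folklore] -/
theorem outKnot_circlePt_eq_A {ε₁ r₁ : ℝ} (hf₁ : b.IsFlat hcross ε₁ r₁) (hε₁ : ε₁ ≤ epsU) (hr₁ : 4 * κ < r₁) {t : ℝ}
    (ht : t ∈ Ico (b.thetaA 10⁻¹) (b.thetaA 10⁻¹ + 1)) (hts : t ∉ Icc b.alo b.ahi) :
    P.outKnot hf₁ hε₁ hr₁ (circlePt t) = A (circlePt t) := by
  have hbm := P.band_marks
  have hw := b.thetaA_window
  rcases lt_or_ge t b.alo with hlt | hge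
  · -- shift by one period
    have e : circlePt t = circlePt (t + 1) := by
      rw [show t + 1 = t + ((1 : ℤ) : ℝ) by push_cast; ring, circlePt_add_int]
    have ht1 : t + 1 ∈ Ico b.alo (b.alo + 1) := ⟨by linarith [ht.1], by linarith⟩
    have hts1 : t + 1 ∉ Icc P.sLo P.sHi := fun h ↦ by linarith [h.2, ht.1]
    rw [e, P.outKnot_circlePt_of_not_mem hf₁ hε₁ hr₁ ht1 hts1]
    apply Subtype.ext
    rw [P.coe_host_circlePt_of_not_mem ht1 hts1, b.neckPiece_of_ahi_le (by linarith [ht.1]), Knot.curve_apply]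
  · have hgt : b.ahi < t := by
      by_contra hc; push Not at hc; exact hts ⟨hge, hc⟩
    have ht1 : t ∈ Ico b.alo (b.alo + 1) := ⟨hge, by linarith [ht.2]⟩
    have hts1 : t ∉ Icc P.sLo P.sHi := fun h ↦ by linarith [h.2]
    rw [P.outKnot_circlePt_of_not_mem hf₁ hε₁ hr₁ ht1 hts1]
    apply Subtype.ext
    rw [P.coe_host_circlePt_of_not_mem ht1 hts1, b.neckPiece_of_ahi_le hgt.le, Knot.curve_apply]

/-- **The retracted host on `[alo, ahi]` is the band image of the initial cleaning track.** [folklore] -/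
theorem coe_outKnot_circlePt_eq_band_cfam {ε₁ r₁ : ℝ} (hf₁ : b.IsFlat hcross ε₁ r₁) (hε₁ : ε₁ ≤ epsU) (hr₁ : 4 * κ < r₁) {s : ℝ}
    (hs : s ∈ Icc b.alo b.ahi) :
    ((P.outKnot hf₁ hε₁ hr₁ (circlePt s) : 𝕊 3) : 𝔼 4) = ((b.band (P.cfam 0 s) : 𝕊 3) : 𝔼 4) := by
  have hbm := P.band_marks
  have hm := b.marks_lt
  by_cases hS : s ∈ Icc P.sLo P.sHi
  · rw [P.outKnot_circlePt_of_mem hf₁ hε₁ hr₁ hS, P.cfam_of_mem_S hS]; rfl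
  · have hsI : s ∈ Ico b.alo (b.alo + 1) := ⟨hs.1, by linarith [hs.2]⟩
    rw [P.outKnot_circlePt_of_not_mem hf₁ hε₁ hr₁ hsI hS, P.coe_host_circlePt_of_not_mem hsI hS]
    rcases lt_or_ge s P.sLo with h1 | h1
    · rw [b.neckPiece_of_lt_tlo (by linarith [P.sLo_spec.2.2]), show P.cfam 0 s = P.famLo 0 s by simp [cfam, h1]]
      congr 2
      ext i; fin_cases i
      · exact (b.neckLo_apply_zero κ 1 s)
      · show b.neckLo κ 1 s 1 = P.famLo 0 s 1; rw [famLo_apply_one]; ring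
    · have h2 : P.sHi < s := by
        by_contra hc; push Not at hc; exact hS ⟨h1, hc⟩
      have hc : P.cfam 0 s = P.famUp 0 s := by simp [cfam, not_lt.2 h1, not_le.2 h2]
      rw [hc]
      rcases lt_or_ge s b.ahi with h3 | h3
      · rw [b.neckPiece_of_thi_le (by linarith [P.sHi_spec.2.1]) h3]
        congr 2
        ext i; fin_cases i
        · exact (b.neckUp_apply_zero κ 1 s)
        · show b.neckUp κ 1 s 1 = P.famUp 0 s 1; rw [famUp_apply_one]; ring
      · have hsa : s = b.ahi := le_antisymm hs.2 h3
        rw [b.neckPiece_of_ahi_le h3, P.famUp_of_ge (by linarith), Knot.curve_apply,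
          ← b.band_railUp_eq_A ⟨by linarith, by linarith⟩]

/-! ### The planar family of the cleaning -/

/-- The base of the band fundamental domain. [folklore] -/
def base (_ : b.HostHyp hcross ε r A' κ lam₀ rA) : ℝ := b.thetaA 10⁻¹

/-- The seam margin. [folklore] -/
def margin (_ : b.HostHyp hcross ε r A' κ lam₀ rA) : ℝ := min (b.alo - b.thetaA 10⁻¹) (b.thetaA 10⁻¹ + 1 - b.ahi) / 2

/-- The margin is positive and fits. [folklore] -/
theorem margin_spec : 0 < P.margin ∧ P.base + P.margin ≤ b.alo ∧ b.ahi ≤ P.base + 1 - P.margin := by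
  have hbm := P.band_marks; have hw := b.thetaA_window
  have h1 : P.margin ≤ (b.alo - b.thetaA 10⁻¹) / 2 := div_le_div_of_nonneg_right (min_le_left _ _) two_pos.le
  have h2 : P.margin ≤ (b.thetaA 10⁻¹ + 1 - b.ahi) / 2 := div_le_div_of_nonneg_right (min_le_right _ _) two_pos.le
  refine ⟨?_, ?_, ?_⟩
  · rw [margin]; exact div_pos (lt_min (by linarith) (by linarith)) two_pos
  · simp only [base]; linarith
  · simp only [base]; linarith

section Planar

variable {ε₁ r₁ : ℝ} (hf₁ : b.IsFlat hcross ε₁ r₁) (hε₁ : ε₁ ≤ epsU) (hr₁ : 4 * κ < r₁)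
include hf₁ hε₁ hr₁

/-- `hh` is injective on the moving interval. [folklore] -/
theorem injOn_hh : InjOn P.hh (Icc P.sLo P.sHi) := by
  intro s hs s' hs' he
  have := P.injOn_mix hf₁ hε₁ hr₁ (u := 1) ⟨zero_le_one, le_rfl⟩ hs hs' (by rw [mix_one, mix_one, he])
  exact this

/-- `hh` has non-vanishing derivative on the moving interval. [folklore] -/
theorem deriv_hh_ne_zero {s : ℝ} (hs : s ∈ Icc P.sLo P.sHi) : deriv P.hh s ≠ 0 := by
  have hκ := P.HU.cone.spike.κ_pos
  have hs0 := P.Icc_sLo_sHi_subset hs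
  have hd : HasDerivAt P.hh (deriv P.hh s) s := ((P.contDiffAt_hh hs0).differentiableAt (by simp)).hasDerivAt
  have hq : ‖κ • P.hh s‖ < r₁ := by
    have hn := P.norm_hh_le hs0
    rw [norm_smul, Real.norm_eq_abs, abs_of_pos hκ]; nlinarith
  obtain ⟨hN, -⟩ := P.hasFDerivAt_Npl hf₁ hq
  have hcomp := hN.comp_hasDerivAt s hd
  have e : P.Npl ∘ P.hh = P.mix 1 := by funext t; simp [mix]
  rw [e] at hcomp
  intro h0
  have := P.deriv_mix_ne_zero hf₁ hε₁ hr₁ (u := 1) ⟨zero_le_one, le_rfl⟩ hs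
  rw [hcomp.deriv, h0, map_zero] at this
  exact this rfl

/-- The middle path has non-vanishing derivative on the moving interval. [folklore] -/
theorem deriv_qS_ne_zero {s : ℝ} (hs : s ∈ Icc P.sLo P.sHi) : deriv P.qS s ≠ 0 := by
  have hκ := P.HU.cone.spike.κ_pos
  have hd : HasDerivAt P.hh (deriv P.hh s) s := ((P.contDiffAt_hh (P.Icc_sLo_sHi_subset hs)).differentiableAt (by simp)).hasDerivAt
  have h : HasDerivAt P.qS (κ • deriv P.hh s) s := by
    have := (hd.const_smul κ).const_add (pt2 2⁻¹ 2⁻¹ : 𝔼 2)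
    exact this
  rw [h.deriv]
  exact smul_ne_zero hκ.ne' (P.deriv_hh_ne_zero hf₁ hε₁ hr₁ hs)

omit hf₁ hε₁ hr₁ in
/-- `famLo u` is differentiable with first-coordinate derivative that of the rail arch. [folklore] -/
theorem hasDerivAt_famLo_zero (u s : ℝ) :
    HasDerivAt (P.famLo u) (deriv (P.famLo u) s) s ∧ deriv (P.famLo u) s 0 = deriv (fun t ↦ b.railLo t 0) s := by
  have hd : DifferentiableAt ℝ (P.famLo u) s := by
    have h1 : DifferentiableAt ℝ (uncurry P.famLo) (u, s) := P.contDiff_famLo.differentiable (by simp) _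
    have h2 : DifferentiableAt ℝ (fun t : ℝ ↦ (u, t)) s := (differentiableAt_const u).prodMk differentiableAt_id
    have := h1.comp s h2; exact this
  refine ⟨hd.hasDerivAt, ?_⟩
  have h := ((EuclideanSpace.proj (0 : Fin 2) : 𝔼 2 →L[ℝ] ℝ).hasFDerivAt).comp_hasDerivAt s hd.hasDerivAt
  have e : (fun t ↦ b.railLo t 0) = (⇑(EuclideanSpace.proj (0 : Fin 2) : 𝔼 2 →L[ℝ] ℝ) ∘ P.famLo u) := by funext t; rfl
  rw [e, h.deriv]; rfl

omit hf₁ hε₁ hr₁ in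
/-- `famUp u` is differentiable with first-coordinate derivative that of the upper rail arch. [folklore] -/
theorem hasDerivAt_famUp_zero (u s : ℝ) :
    HasDerivAt (P.famUp u) (deriv (P.famUp u) s) s ∧ deriv (P.famUp u) s 0 = deriv (fun t ↦ b.railUp t 0) s := by
  have hd : DifferentiableAt ℝ (P.famUp u) s := by
    have h1 : DifferentiableAt ℝ (uncurry P.famUp) (u, s) := P.contDiff_famUp.differentiable (by simp) _
    have h2 : DifferentiableAt ℝ (fun t : ℝ ↦ (u, t)) s := (differentiableAt_const u).prodMk differentiableAt_id
    have := h1.comp s h2; exact this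
  refine ⟨hd.hasDerivAt, ?_⟩
  have h := ((EuclideanSpace.proj (0 : Fin 2) : 𝔼 2 →L[ℝ] ℝ).hasFDerivAt).comp_hasDerivAt s hd.hasDerivAt
  have e : (fun t ↦ b.railUp t 0) = (⇑(EuclideanSpace.proj (0 : Fin 2) : 𝔼 2 →L[ℝ] ℝ) ∘ P.famUp u) := by funext t; rfl
  rw [e, h.deriv]; rfl

omit hf₁ hε₁ hr₁ in
/-- The first coordinate of the upper rail arch has negative derivative on `(thi + ε', ahi - ε')`.
[folklore] -/
theorem deriv_railUp_zero_neg {t : ℝ} (ht : t ∈ Ioo (b.thi + b.epsHi) (b.ahi - b.epsHi)) :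
    deriv (fun t ↦ b.railUp t 0) t < 0 := by
  have hab : -b.ahi + b.epsHi < -b.thi - b.epsHi := by linarith [b.cUp_hyp.2.1, b.cUp_hyp.1]
  have hd : HasDerivAt (fun t ↦ b.railUp t 0) (deriv (smoothStep (-b.ahi + b.epsHi) (-b.thi - b.epsHi)) (-t) * (-1)) t := by
    have h := ((differentiable_smoothStep (-b.ahi + b.epsHi) (-b.thi - b.epsHi)) (-t)).hasDerivAt
    exact h.comp t (hasDerivAt_neg t)
  rw [hd.deriv]
  have hpos := deriv_smoothStep_pos hab (x := -t) ⟨by linarith [ht.2], by linarith [ht.1]⟩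
  linarith

/-- **The regularity of the cleaning tracks.** [folklore] -/
theorem deriv_cfam_ne_zero {u : ℝ} (_hu : u ∈ Icc (0 : ℝ) 1) {s : ℝ} (_hs : s ∈ Icc b.alo b.ahi) : deriv (P.cfam u) s ≠ 0 := by
  obtain ⟨-, -, hb3, hb4, hb5, hb6, hb7, -, -, hεL, hεH, hb12, hb13⟩ := P.band_marks
  have hq := P.paramLo_spec quarter_mem07; have hqc := P.paramLo_mem_core quarter_mem07
  have hq' := P.paramHi_spec quarter_mem07; have hqc' := P.paramHi_mem_core quarter_mem07
  have hsl := P.sLo_spec; have hsh := P.sHi_spec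
  have hql : P.sLo < P.paramLo quarter_mem07 :=
    (P.alphaLo_lt_iff quarter_mem07 (P.paramLo_mem_core sixteenth_mem07)).1
      (by rw [show b.alphaLo κ (P.paramLo sixteenth_mem07) = 1 / 16 from hsl.1]; norm_num)
  have hqh : P.paramHi quarter_mem07 < P.sHi :=
    (P.alphaHi_lt_iff quarter_mem07 (P.paramHi_mem_core sixteenth_mem07)).1
      (by rw [show b.alphaHi κ (P.paramHi sixteenth_mem07) = 1 / 16 from hsh.1]; norm_num)
  by_cases h1 : s < b.alo + 3 / 2 * b.epsLo
  · -- near the left edge the track is the rail arch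
    have hev : P.cfam u =ᶠ[𝓝 s] b.railLo := by
      filter_upwards [Iio_mem_nhds h1] with t (ht : t < b.alo + 3 / 2 * b.epsLo)
      rw [P.cfam_of_lt_quarterLo (by linarith [hqc.1]), P.famLo_of_le ht.le]
    rw [hev.deriv_eq]; exact b.deriv_railLo_ne_zero s
  by_cases h2 : s < P.paramLo quarter_mem07
  · push Not at h1
    have hev : P.cfam u =ᶠ[𝓝 s] P.famLo u := by
      filter_upwards [Iio_mem_nhds h2] with t ht using P.cfam_of_lt_quarterLo ht
    rw [hev.deriv_eq]
    intro h0
    have hx := (P.hasDerivAt_famLo_zero u s).2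
    rw [h0] at hx
    have hpos := b.deriv_railLo_zero_pos (t := s) ⟨by linarith, by linarith [hqc.2]⟩
    rw [← hx] at hpos; simp at hpos
  by_cases h3 : s ≤ P.paramHi quarter_mem07
  · push Not at h2
    have h0 := P.paramLo_spec zero_mem07; have h0' := P.paramHi_spec zero_mem07
    have hlt : P.paramLo zero_mem07 < P.paramLo quarter_mem07 := by
      rw [← P.alphaLo_lt_iff quarter_mem07 (P.paramLo_mem_core zero_mem07), h0.2]; norm_num
    have hlt' : P.paramHi quarter_mem07 < P.paramHi zero_mem07 := by
      rw [← P.alphaHi_lt_iff quarter_mem07 (P.paramHi_mem_core zero_mem07), h0'.2]; norm_num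
    have hev : P.cfam u =ᶠ[𝓝 s] P.qS := by
      filter_upwards [Ioo_mem_nhds (show P.paramLo zero_mem07 < s by linarith) (show s < P.paramHi zero_mem07 by linarith)] with t ht
      exact P.cfam_of_mem_region ht
    rw [hev.deriv_eq]
    exact P.deriv_qS_ne_zero hf₁ hε₁ hr₁ ⟨by linarith, by linarith⟩
  by_cases h4 : s ≤ b.ahi - 3 / 2 * b.epsHi
  · push Not at h3
    have hev : P.cfam u =ᶠ[𝓝 s] P.famUp u := by
      filter_upwards [Ioi_mem_nhds h3] with t ht using P.cfam_of_quarterHi_lt ht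
    rw [hev.deriv_eq]
    intro h0
    have hx := (P.hasDerivAt_famUp_zero u s).2
    rw [h0] at hx
    have hneg := deriv_railUp_zero_neg (b := b) (t := s) ⟨by linarith [hqc'.1, hsh.2.1], by linarith⟩
    rw [← hx] at hneg; simp at hneg
  · push Not at h4
    have hev : P.cfam u =ᶠ[𝓝 s] b.railUp := by
      filter_upwards [Ioi_mem_nhds h4] with t (ht : b.ahi - 3 / 2 * b.epsHi < t)
      rw [P.cfam_of_quarterHi_lt (by linarith [hqc'.2]), P.famUp_of_ge ht.le]
    rw [hev.deriv_eq]; exact b.deriv_railUp_ne_zero s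

/-- **The cleaning tracks are injective on the band window.** [folklore] -/
theorem injOn_cfam {u : ℝ} (hu : u ∈ Icc (0 : ℝ) 1) : InjOn (P.cfam u) (Icc b.alo b.ahi) := by
  have hbm := P.band_marks
  have hκ := P.HU.cone.spike.κ_pos
  have hsl := P.sLo_spec; have hsh := P.sHi_spec
  -- values by zone
  have hL : ∀ {s}, s ∈ Icc b.alo b.ahi → s < P.sLo → P.cfam u s = P.famLo u s ∧ P.cfam u s 0 < 1 / 2 + κ / 16 ∧ P.cfam u s 1 ≤ 1 / 2 - κ :=
    fun {s} hs h ↦ by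
      have e : P.cfam u s = P.famLo u s := by simp [cfam, h]
      refine ⟨e, ?_, ?_⟩
      · rw [e, famLo_apply_zero]; exact P.railLo_zero_lt_of_lt_sLo h
      · rw [e]; exact (P.famLo_one_mem hu ⟨hs.1, h⟩).2
  have hM : ∀ {s}, s ∈ Icc P.sLo P.sHi → P.cfam u s = P.qS s ∧ 1 / 2 + κ / 16 ≤ P.cfam u s 0 :=
    fun {s} hs ↦ by
      have e := P.cfam_of_mem_S (u := u) hs
      exact ⟨e, by rw [e]; exact (P.qS_zero_mem hs).1⟩
  have hU : ∀ {s}, s ∈ Icc b.alo b.ahi → P.sHi < s → P.cfam u s = P.famUp u s ∧ P.cfam u s 0 < 1 / 2 + κ / 16 ∧ 1 / 2 + κ ≤ P.cfam u s 1 :=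
    fun {s} hs h ↦ by
      have e : P.cfam u s = P.famUp u s := by simp [cfam, not_lt.2 (hbm.2.2.2.2.1.le.trans h.le), not_le.2 h]
      refine ⟨e, ?_, ?_⟩
      · rw [e, famUp_apply_zero]; exact P.railUp_zero_lt_of_sHi_lt h
      · rw [e]; exact (P.famUp_one_mem hu ⟨h, hs.2⟩).1
  -- injectivity of the three pieces
  have hinjL : ∀ {s s'}, s < P.sLo → s' < P.sLo → P.famLo u s = P.famLo u s' → s = s' := by
    intro s s' hs hs' he
    have h0 : b.railLo s 0 = b.railLo s' 0 := by rw [← famLo_apply_zero P u s, he, famLo_apply_zero]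
    by_contra hne
    rcases lt_or_gt_of_ne hne with hlt | hlt
    · rcases le_or_gt s' (b.alo + 3 / 2 * b.epsLo) with h1 | h1
      · rw [P.famLo_of_le (by linarith), P.famLo_of_le h1] at he
        exact hne (b.injective_railLo he)
      · have hsI : s' ∈ Icc (b.alo + b.epsLo) (b.tlo - b.epsLo) := ⟨by linarith, by linarith [hsl.2.2]⟩
        rcases le_or_gt s (b.alo + b.epsLo) with h2 | h2
        · have hx0 : b.railLo s 0 = 0 := by rw [b.railLo_eq_left h2, pt2_apply_zero]
          have hx1 := b.railLo_zero_mem_Ioo (t := s') ⟨by linarith, by linarith [hsl.2.2]⟩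
          rw [h0] at hx0; linarith [hx1.1]
        · have := b.strictMonoOn_railLo_zero ⟨h2.le, by linarith [hsl.2.2]⟩ hsI hlt
          exact absurd h0 this.ne
    · rcases le_or_gt s (b.alo + 3 / 2 * b.epsLo) with h1 | h1
      · rw [P.famLo_of_le h1, P.famLo_of_le (by linarith)] at he
        exact hne (b.injective_railLo he)
      · have hsI : s ∈ Icc (b.alo + b.epsLo) (b.tlo - b.epsLo) := ⟨by linarith, by linarith [hsl.2.2]⟩
        rcases le_or_gt s' (b.alo + b.epsLo) with h2 | h2
        · have hx0 : b.railLo s' 0 = 0 := by rw [b.railLo_eq_left h2, pt2_apply_zero]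
          have hx1 := b.railLo_zero_mem_Ioo (t := s) ⟨by linarith, by linarith [hsl.2.2]⟩
          rw [← h0] at hx0; linarith [hx1.1]
        · have := b.strictMonoOn_railLo_zero ⟨h2.le, by linarith [hsl.2.2]⟩ hsI hlt
          exact absurd h0.symm this.ne
  have hinjU : ∀ {s s'}, P.sHi < s → P.sHi < s' → P.famUp u s = P.famUp u s' → s = s' := by
    intro s s' hs hs' he
    have h0 : b.railUp s 0 = b.railUp s' 0 := by rw [← famUp_apply_zero P u s, he, famUp_apply_zero]
    by_contra hne
    rcases lt_or_gt_of_ne hne with hlt | hlt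
    · rcases le_or_gt (b.ahi - 3 / 2 * b.epsHi) s with h1 | h1
      · rw [P.famUp_of_ge h1, P.famUp_of_ge (by linarith)] at he
        exact hne (b.injective_railUp he)
      · have hsI : s ∈ Icc (b.thi + b.epsHi) (b.ahi - b.epsHi) := ⟨by linarith [hsh.2.1], by linarith⟩
        rcases le_or_gt (b.ahi - b.epsHi) s' with h2 | h2
        · have hx0 : b.railUp s' 0 = 0 := by rw [b.railUp_eq_left h2, pt2_apply_zero]
          have hx1 := b.railUp_zero_mem_Ioo (t := s) ⟨by linarith [hsh.2.1], by linarith⟩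
          rw [← h0] at hx0; linarith [hx1.1]
        · have := b.strictAntiOn_railUp_zero hsI ⟨by linarith [hsh.2.1], h2.le⟩ hlt
          exact absurd h0.symm this.ne
    · rcases le_or_gt (b.ahi - 3 / 2 * b.epsHi) s' with h1 | h1
      · rw [P.famUp_of_ge (by linarith), P.famUp_of_ge h1] at he
        exact hne (b.injective_railUp he)
      · have hsI : s' ∈ Icc (b.thi + b.epsHi) (b.ahi - b.epsHi) := ⟨by linarith [hsh.2.1], by linarith⟩
        rcases le_or_gt (b.ahi - b.epsHi) s with h2 | h2
        · have hx0 : b.railUp s 0 = 0 := by rw [b.railUp_eq_left h2, pt2_apply_zero]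
          have hx1 := b.railUp_zero_mem_Ioo (t := s') ⟨by linarith [hsh.2.1], by linarith⟩
          rw [h0] at hx0; linarith [hx1.1]
        · have := b.strictAntiOn_railUp_zero hsI ⟨by linarith [hsh.2.1], h2.le⟩ hlt
          exact absurd h0 this.ne
  have hinjM : ∀ {s s'}, s ∈ Icc P.sLo P.sHi → s' ∈ Icc P.sLo P.sHi → P.qS s = P.qS s' → s = s' := by
    intro s s' hs hs' he
    refine P.injOn_hh hf₁ hε₁ hr₁ hs hs' ?_
    have : κ • P.hh s = κ • P.hh s' := by
      have := congrArg (fun q : 𝔼 2 ↦ q - pt2 2⁻¹ 2⁻¹) he; simpa [qS] using this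
    exact smul_right_injective _ hκ.ne' this
  -- assemble
  intro s hs s' hs' he
  rcases lt_or_ge s P.sLo with h1 | h1 <;> rcases lt_or_ge s' P.sLo with h1' | h1'
  · exact hinjL h1 h1' (by rw [← (hL hs h1).1, ← (hL hs' h1').1, he])
  · exfalso
    rcases le_or_gt s' P.sHi with h2' | h2'
    · have := (hL hs h1).2.1; have := (hM ⟨h1', h2'⟩).2; rw [he] at *; linarith
    · have := (hL hs h1).2.2; have := (hU hs' h2').2.2; rw [he] at *; linarith
  · exfalso
    rcases le_or_gt s P.sHi with h2 | h2
    · have := (hL hs' h1').2.1; have := (hM ⟨h1, h2⟩).2; rw [← he] at *; linarith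
    · have := (hL hs' h1').2.2; have := (hU hs h2).2.2; rw [← he] at *; linarith
  · rcases le_or_gt s P.sHi with h2 | h2 <;> rcases le_or_gt s' P.sHi with h2' | h2'
    · exact hinjM ⟨h1, h2⟩ ⟨h1', h2'⟩ (by rw [← (hM ⟨h1, h2⟩).1, ← (hM ⟨h1', h2'⟩).1, he])
    · exfalso; have := (hM ⟨h1, h2⟩).2; have := (hU hs' h2').2.1; rw [he] at *; linarith
    · exfalso; have := (hM ⟨h1', h2'⟩).2; have := (hU hs h2).2.1; rw [← he] at *; linarith
    · exact hinjU h2 h2' (by rw [← (hU hs h2).1, ← (hU hs' h2').1, he])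

omit hf₁ hε₁ hr₁ in
/-- **The cleaning tracks lie in the square neighbourhood.** [folklore] -/
theorem cfam_mem {u : ℝ} (hu : u ∈ Icc (0 : ℝ) 1) {s : ℝ} (hs : s ∈ Icc b.alo b.ahi) : P.cfam u s ∈ squareNhd b.δ := by
  have hbm := P.band_marks
  have hκ := P.HU.cone.spike.κ_pos
  have hκ12 := P.HU.cone.spike.κ_le
  have hδ := b.δ_pos
  rw [mem_squareNhd_iff, Fin.forall_fin_two]
  rcases lt_or_ge s P.sLo with h1 | h1
  · have e : P.cfam u s = P.famLo u s := by simp [cfam, h1]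
    rw [e, famLo_apply_zero]
    have hx := b.railLo_zero_mem_Icc s
    have hy := P.famLo_one_mem hu ⟨hs.1, h1⟩
    exact ⟨⟨by linarith [hx.1], by linarith [hx.2]⟩, ⟨by linarith [hy.1], by linarith [hy.2]⟩⟩
  rcases le_or_gt s P.sHi with h2 | h2
  · rw [P.cfam_of_mem_S ⟨h1, h2⟩, qS_apply_one]
    have hx := P.qS_zero_mem ⟨h1, h2⟩
    have hy := abs_le.1 (P.hh_bounds ⟨h1, h2⟩).1
    refine ⟨⟨by linarith [hx.1], by linarith [hx.2]⟩, ⟨by nlinarith [hy.1], by nlinarith [hy.2]⟩⟩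
  · have e : P.cfam u s = P.famUp u s := by simp [cfam, not_lt.2 h1, not_le.2 h2]
    rw [e, famUp_apply_zero]
    have hx := b.railUp_zero_mem_Icc s
    have hy := P.famUp_one_mem hu ⟨h2, hs.2⟩
    exact ⟨⟨by linarith [hx.1], by linarith [hx.2]⟩, ⟨by linarith [hy.1], by linarith [hy.2]⟩⟩

omit hf₁ hε₁ hr₁ in
/-- A cleaning track point on the left edge is a left-zone rail arch point. [folklore] -/
theorem cfam_zero_eq_zero_imp {u s : ℝ} (h0 : P.cfam u s 0 = 0) :
    (s ≤ b.alo + b.epsLo ∧ P.cfam u s = b.railLo s) ∨ (b.ahi - b.epsHi ≤ s ∧ P.cfam u s = b.railUp s) := by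
  have hbm := P.band_marks
  have hκ := P.HU.cone.spike.κ_pos
  have hsl := P.sLo_spec; have hsh := P.sHi_spec
  rcases lt_or_ge s P.sLo with h1 | h1
  · left
    have e : P.cfam u s = P.famLo u s := by simp [cfam, h1]
    rw [e, famLo_apply_zero] at h0
    have hle : s ≤ b.alo + b.epsLo := by
      by_contra hc; push Not at hc
      have := b.railLo_zero_mem_Ioo (t := s) ⟨hc, by linarith [hsl.2.2]⟩
      linarith [this.1]
    exact ⟨hle, by rw [e, P.famLo_of_le (by linarith)]⟩
  rcases le_or_gt s P.sHi with h2 | h2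
  · exfalso
    have := (P.qS_zero_mem ⟨h1, h2⟩).1
    rw [P.cfam_of_mem_S ⟨h1, h2⟩] at h0; linarith
  · right
    have e : P.cfam u s = P.famUp u s := by simp [cfam, not_lt.2 h1, not_le.2 h2]
    rw [e, famUp_apply_zero] at h0
    have hle : b.ahi - b.epsHi ≤ s := by
      by_contra hc; push Not at hc
      have := b.railUp_zero_mem_Ioo (t := s) ⟨by linarith [hsh.2.1], hc⟩
      linarith [this.1]
    exact ⟨hle, by rw [e, P.famUp_of_ge (by linarith)]⟩

/-- **The planar family of the cleaning.** [folklore] -/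
theorem planarFamily : b.PlanarFamily (P.outKnot hf₁ hε₁ hr₁) P.base P.margin b.alo (b.alo + 3 / 2 * b.epsLo)
    (b.ahi - 3 / 2 * b.epsHi) b.ahi P.cfam where
  ε_pos := P.margin_spec.1
  hs := by
    have hbm := P.band_marks; have hms := P.margin_spec
    exact ⟨hms.2.1, by linarith, by linarith, by linarith, hms.2.2⟩
  contDiff := P.contDiff_cfam
  eq_zero u t ht := by
    have hbm := P.band_marks
    rcases le_or_gt t (b.alo + 3 / 2 * b.epsLo) with h1 | h1
    · have e : ∀ v, P.cfam v t = b.railLo t := fun v ↦ by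
        rw [show P.cfam v t = P.famLo v t by simp [cfam, show t < P.sLo by linarith], P.famLo_of_le h1]
      rw [e, e]
    · have h2 : b.ahi - 3 / 2 * b.epsHi ≤ t := by
        by_contra hc; push Not at hc; exact ht ⟨h1, hc⟩
      have e : ∀ v, P.cfam v t = b.railUp t := fun v ↦ by
        rw [show P.cfam v t = P.famUp v t by
          simp [cfam, not_lt.2 (show P.sLo ≤ t by linarith), not_le.2 (show P.sHi < t by linarith)], P.famUp_of_ge h2]
      rw [e, e]
  curve_eq s hs := by rw [Knot.curve_apply, P.coe_outKnot_circlePt_eq_band_cfam hf₁ hε₁ hr₁ hs]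
  mem u hu s hs := P.cfam_mem hu hs
  deriv_ne u hu s hs := P.deriv_cfam_ne_zero hf₁ hε₁ hr₁ hu hs
  injOn u hu := P.injOn_cfam hf₁ hε₁ hr₁ hu
  disjoint u hu s hs t ht hts he := by
    have hbm := P.band_marks; have hw := b.thetaA_window
    have htA : t ∉ Icc b.alo b.ahi := hts
    rw [Knot.curve_apply, P.outKnot_circlePt_eq_A hf₁ hε₁ hr₁ ht htA] at he
    have hmem : P.cfam u s ∈ b.band ⁻¹' range A ∩ squareNhd b.δ := ⟨⟨circlePt t, (Subtype.ext he).symm⟩, P.cfam_mem hu hs⟩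
    rw [b.preimage_left] at hmem
    -- the track point is an edge point of a rail arch, a point of `A` with parameter `s`
    have hA : b.band (P.cfam u s) = A (circlePt s) := by
      rcases P.cfam_zero_eq_zero_imp hmem.2 with ⟨h1, e⟩ | ⟨h1, e⟩
      · rw [e]; exact b.band_railLo_eq_A ⟨by linarith [hs.1], h1⟩
      · rw [e]; exact b.band_railUp_eq_A ⟨h1, by linarith [hs.2]⟩
    have heq : A (circlePt t) = A (circlePt s) := by rw [← hA]; exact (Subtype.ext he).symm
    obtain ⟨m, hm⟩ := circlePt_eq_circlePt_iff.1 (A.injective heq)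
    simp only [base] at ht
    have h1 : (m : ℝ) < 1 := by linarith [ht.2, hs.1]
    have h2 : (-1 : ℝ) < m := by linarith [ht.1, hs.2]
    have h1' : m < 1 := by exact_mod_cast h1
    have h2' : -1 < m := by exact_mod_cast h2
    obtain rfl : m = 0 := by omega
    simp only [Int.cast_zero, add_zero] at hm
    exact hts (hm ▸ hs)

/-- **The cleaned knot** `k♭`. [folklore] -/
def cleanKnot : Knot := (P.planarFamily hf₁ hε₁ hr₁).outKnot

/-- The retracted host is isotopic to the cleaned knot. [folklore] -/
theorem isIsotopic_outKnot_cleanKnot : (P.outKnot hf₁ hε₁ hr₁).IsIsotopic (P.cleanKnot hf₁ hε₁ hr₁) :=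
  (P.planarFamily hf₁ hε₁ hr₁).isIsotopic_outKnot

end Planar

/-! ### Derivatives along the final track -/

omit P in
/-- `gLoT` is non-decreasing. [folklore] -/
theorem deriv_gLoT_nonneg (α : ℝ) : 0 ≤ deriv gLoT α := by
  have hw : HasDerivAt wCut (deriv (smoothStep (1 / 4 + 1 / 48) (1 / 4 + 1 / 24)) α) α :=
    ((differentiable_smoothStep (1 / 4 + 1 / 48) (1 / 4 + 1 / 24)) α).hasDerivAt
  have h : HasDerivAt gLoT (deriv (smoothStep (1 / 4 + 1 / 48) (1 / 4 + 1 / 24)) α * (4 / 3 * (α - 1 / 4)) + wCut α * (4 / 3 * 1)) α := by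
    have e : gLoT = fun x ↦ -1 + wCut x * (4 / 3 * (x - 1 / 4)) := rfl
    rw [e]
    exact (hw.mul (((hasDerivAt_id α).sub_const (1 / 4 : ℝ)).const_mul (4 / 3 : ℝ))).const_add (-1 : ℝ)
  rw [h.deriv]
  have hab : (1 / 4 + 1 / 48 : ℝ) < 1 / 4 + 1 / 24 := by norm_num
  have hd := deriv_smoothStep_nonneg hab α
  have hwm := wCut_mem α
  rcases le_or_gt (1 / 4) α with h14 | h14
  · nlinarith [hwm.1]
  · rw [deriv_smoothStep_of_lt hab (by linarith), wCut_of_le (by linarith)]; norm_num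

omit P in
/-- `gHiT` is non-increasing. [folklore] -/
theorem deriv_gHiT_nonpos (α : ℝ) : deriv gHiT α ≤ 0 := by
  have e : gHiT = -gLoT := by funext x; simp [gHiT, gLoT]; ring
  rw [e, deriv.neg]; linarith [deriv_gLoT_nonneg α]

/-- A parameter `≥ s₀` with `αLo < 7` lies in the OPEN lower core. [folklore] -/
theorem mem_open_coreLo {s : ℝ} (hs : P.sLo ≤ s) (hα : b.alphaLo κ s < 7) : s ∈ Ioo (b.tcLo - b.epsLo / 8) (b.tcLo + b.epsLo / 8) := by
  have hκ := P.HU.cone.spike.κ_pos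
  have hsc := P.mem_coreLo_of_alphaLo_lt (P.sLo_spec.2.1.trans hs) hα
  refine ⟨by linarith [P.sLo_spec.2.1, b.epsLo_bounds.1], lt_of_le_of_ne hsc.2 fun he ↦ ?_⟩
  have h7 : 7 ≤ b.alphaLo κ (b.tcLo + b.epsLo / 8) := by
    rw [alphaLo, le_div_iff₀ hκ]
    have : b.gapLo ≤ b.chiLo (b.tcLo + b.epsLo / 8) - 1 / 2 := min_le_left _ _
    linarith [P.HU.cone.spike.seven_le_gapLo]
  rw [he] at hα; linarith

/-- A parameter `≤ s₀'` with `αHi < 7` lies in the OPEN upper core. [folklore] -/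
theorem mem_open_coreHi {s : ℝ} (hs : s ≤ P.sHi) (hα : b.alphaHi κ s < 7) : s ∈ Ioo (b.tcHi - b.epsHi / 8) (b.tcHi + b.epsHi / 8) := by
  have hκ := P.HU.cone.spike.κ_pos
  have hsc := P.mem_coreHi_of_alphaHi_lt (hs.trans P.sHi_spec.2.2) hα
  refine ⟨lt_of_le_of_ne hsc.1 fun he ↦ ?_, by linarith [P.sHi_spec.2.2, b.epsHi_bounds.1]⟩
  have h7 : 7 ≤ b.alphaHi κ (b.tcHi - b.epsHi / 8) := by
    rw [alphaHi, le_div_iff₀ hκ]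
    have : b.gapHi ≤ b.chiHi (b.tcHi - b.epsHi / 8) - 1 / 2 := min_le_left _ _
    linarith [P.HU.cone.spike.seven_le_gapHi]
  rw [← he] at hα; linarith

/-- **Derivatives of the middle path** on the moving interval (for `κ tgtLip ≤ 1`): the height is
non-decreasing and the turning condition about `1/2` holds. [folklore] -/
theorem qS_derivs (hκt : κ * tgtLip ≤ 1) {s : ℝ} (hs : s ∈ Icc P.sLo P.sHi) :
    ∃ d0 d1 : ℝ, HasDerivAt (fun t ↦ P.qS t 0) d0 s ∧ HasDerivAt (fun t ↦ P.qS t 1) d1 s ∧ 0 ≤ d1 ∧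
      (P.qS s 1 - 1 / 2) * d0 < 3 * d1 := by
  have hκ := P.HU.cone.spike.κ_pos
  have hε := epsP_pos
  have hc := (b.contDiff_alphaLo κ).continuous; have hc' := (b.contDiff_alphaHi κ).continuous
  by_cases hL : b.alphaLo κ s < 3 / 8
  · -- lower blend: `hh = (αLo, gLoT αLo)` near `s`
    have hso := P.mem_open_coreLo hs.1 (by linarith)
    have hsc := Ioo_subset_Icc_self hso
    have hev : P.hh =ᶠ[𝓝 s] fun t ↦ pt2 (b.alphaLo κ t) (gLoT (b.alphaLo κ t)) := by
      have h1 : ∀ᶠ t in 𝓝 s, t ∈ Ioo (b.tcLo - b.epsLo / 8) (b.tcLo + b.epsLo / 8) := isOpen_Ioo.mem_nhds hso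
      have h2 : ∀ᶠ t in 𝓝 s, b.alphaLo κ t < 3 / 8 := hc.continuousAt.eventually (Iio_mem_nhds hL)
      filter_upwards [h1, h2] with t h1 h2 using P.hh_zoneLo (Ioo_subset_Icc_self h1) h2.le
    have hA : HasDerivAt (b.alphaLo κ) (deriv b.chiLo s / κ) s := b.hasDerivAt_alphaLo κ s
    have hApos : 0 < deriv b.chiLo s / κ := div_pos (b.deriv_chiLo_pos hsc) hκ
    set α := b.alphaLo κ s with hαdef
    have h16 := P.alphaLo_ge_of_mem hs
    obtain ⟨hG, -⟩ := hasDerivAt_gLoT α ⟨by linarith, by linarith⟩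
    have hGn := deriv_gLoT_nonneg α
    have h0 : HasDerivAt (fun t ↦ P.qS t 0) (κ * (deriv b.chiLo s / κ)) s := by
      have h := (hA.const_mul κ).const_add (1 / 2 : ℝ)
      refine h.congr_of_eventuallyEq ?_
      filter_upwards [hev] with t ht
      rw [qS_apply_zero, ht, pt2_apply_zero]
    have h1 : HasDerivAt (fun t ↦ P.qS t 1) (κ * (deriv gLoT α * (deriv b.chiLo s / κ))) s := by
      have h := ((hG.comp s hA).const_mul κ).const_add (1 / 2 : ℝ)
      refine h.congr_of_eventuallyEq ?_
      filter_upwards [hev] with t ht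
      rw [qS_apply_one, ht, pt2_apply_one]; rfl
    have hy : P.qS s 1 - 1 / 2 = κ * gLoT α := by rw [qS_apply_one, P.hh_zoneLo hsc hL.le, pt2_apply_one]; ring
    have hg : gLoT α ≤ -(5 / 6) := by
      have := gLoT_le α
      have : max (α - 1 / 4) 0 ≤ 1 / 8 := max_le (by linarith) (by norm_num)
      linarith
    refine ⟨_, _, h0, h1, by positivity, ?_⟩
    rw [hy]
    have : κ * gLoT α * (κ * (deriv b.chiLo s / κ)) < 0 := by
      have h1' : κ * gLoT α < 0 := by nlinarith
      exact mul_neg_of_neg_of_pos h1' (by positivity)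
    have : 0 ≤ 3 * (κ * (deriv gLoT α * (deriv b.chiLo s / κ))) := by positivity
    linarith
  by_cases hH : b.alphaHi κ s < 3 / 8
  · -- upper blend
    have hso := P.mem_open_coreHi hs.2 (by linarith)
    have hsc := Ioo_subset_Icc_self hso
    have hev : P.hh =ᶠ[𝓝 s] fun t ↦ pt2 (b.alphaHi κ t) (gHiT (b.alphaHi κ t)) := by
      have h1 : ∀ᶠ t in 𝓝 s, t ∈ Ioo (b.tcHi - b.epsHi / 8) (b.tcHi + b.epsHi / 8) := isOpen_Ioo.mem_nhds hso
      have h2 : ∀ᶠ t in 𝓝 s, b.alphaHi κ t < 3 / 8 := hc'.continuousAt.eventually (Iio_mem_nhds hH)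
      filter_upwards [h1, h2] with t h1 h2 using P.hh_zoneHi (Ioo_subset_Icc_self h1) h2.le
    have hA : HasDerivAt (b.alphaHi κ) (deriv b.chiHi s / κ) s := b.hasDerivAt_alphaHi κ s
    have hAneg : deriv b.chiHi s / κ < 0 := div_neg_of_neg_of_pos (b.deriv_chiHi_neg hsc) hκ
    set α := b.alphaHi κ s with hαdef
    have h16 := P.alphaHi_ge_of_mem hs
    obtain ⟨hG, -⟩ := hasDerivAt_gHiT α ⟨by linarith, by linarith⟩
    have hGn := deriv_gHiT_nonpos α
    have h0 : HasDerivAt (fun t ↦ P.qS t 0) (κ * (deriv b.chiHi s / κ)) s := by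
      have h := (hA.const_mul κ).const_add (1 / 2 : ℝ)
      refine h.congr_of_eventuallyEq ?_
      filter_upwards [hev] with t ht
      rw [qS_apply_zero, ht, pt2_apply_zero]
    have h1 : HasDerivAt (fun t ↦ P.qS t 1) (κ * (deriv gHiT α * (deriv b.chiHi s / κ))) s := by
      have h := ((hG.comp s hA).const_mul κ).const_add (1 / 2 : ℝ)
      refine h.congr_of_eventuallyEq ?_
      filter_upwards [hev] with t ht
      rw [qS_apply_one, ht, pt2_apply_one]; rfl
    have hy : P.qS s 1 - 1 / 2 = κ * gHiT α := by rw [qS_apply_one, P.hh_zoneHi hsc hH.le, pt2_apply_one]; ring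
    have hg : 5 / 6 ≤ gHiT α := by
      have := le_gHiT α
      have : max (α - 1 / 4) 0 ≤ 1 / 8 := max_le (by linarith) (by norm_num)
      linarith
    have hd1 : 0 ≤ κ * (deriv gHiT α * (deriv b.chiHi s / κ)) := mul_nonneg hκ.le (mul_nonneg_of_nonpos_of_nonpos hGn hAneg.le)
    refine ⟨_, _, h0, h1, hd1, ?_⟩
    rw [hy]
    have : κ * gHiT α * (κ * (deriv b.chiHi s / κ)) < 0 := by
      have h1' : 0 < κ * gHiT α := by nlinarith
      exact mul_neg_of_pos_of_neg h1' (by nlinarith)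
    linarith
  · -- the hairpin `tgt ∘ mu`
    push Not at hL hH
    have hq := P.paramLo_spec quarter_mem07; have hq' := P.paramHi_spec quarter_mem07
    have h0s := P.paramLo_spec zero_mem07; have h0s' := P.paramHi_spec zero_mem07
    have hsq : s ∈ Ioo (P.paramLo quarter_mem07) (P.paramHi quarter_mem07) := by
      constructor
      · by_contra hcn; push Not at hcn
        have hsc : s ∈ Icc (b.tcLo - b.epsLo / 8) (b.tcLo + b.epsLo / 8) :=
          ⟨by linarith [hs.1, P.sLo_spec.2.1, b.epsLo_bounds.1], hcn.trans (P.paramLo_mem_core quarter_mem07).2⟩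
        have := (P.alphaLo_le_iff quarter_mem07 hsc).2 hcn; linarith
      · by_contra hcn; push Not at hcn
        have hsc : s ∈ Icc (b.tcHi - b.epsHi / 8) (b.tcHi + b.epsHi / 8) :=
          ⟨(P.paramHi_mem_core quarter_mem07).1.trans hcn, by linarith [hs.2, P.sHi_spec.2.2, b.epsHi_bounds.1]⟩
        have := (P.alphaHi_le_iff quarter_mem07 hsc).2 hcn; linarith
    have hs0 : s ∈ Icc (P.paramLo zero_mem07) (P.paramHi zero_mem07) := P.Icc_sLo_sHi_subset hs
    have hμ : HasDerivAt P.mu (deriv P.mu s) s := ((P.contDiffAt_mu hs0).differentiableAt (by simp)).hasDerivAt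
    have hμpos : 0 < deriv P.mu s := P.deriv_mu_pos hsq
    have hev : P.hh =ᶠ[𝓝 s] fun t ↦ tgt (P.mu t) := by
      have h1 : ∀ᶠ t in 𝓝 s, 1 / 4 + 1 / 24 < b.alphaLo κ t := hc.continuousAt.eventually (Ioi_mem_nhds (by linarith))
      have h2 : ∀ᶠ t in 𝓝 s, 1 / 4 + 1 / 24 < b.alphaHi κ t := hc'.continuousAt.eventually (Ioi_mem_nhds (by linarith))
      filter_upwards [h1, h2] with t h1 h2 using P.hh_of_ge h1.le h2.le
    set m := P.mu s with hm
    have hmm : m ∈ Icc (-epsP) 1 := P.mu_mem ⟨hsq.1.le, hsq.2.le⟩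
    have hT0 : HasDerivAt (fun m ↦ tgt m 0) (deriv (fun m ↦ tgt m 0) m) m :=
      (((contDiff_euclidean.1 contDiff_tgt 0).differentiable (by simp)) m).hasDerivAt
    obtain ⟨hT1, hT1pos⟩ := deriv_tgt_one_pos m
    have hD0 := abs_deriv_tgt_zero_le m
    set D0 := deriv (fun m ↦ tgt m 0) m
    set D1 := deriv (fun m ↦ tgt m 1) m
    have h0 : HasDerivAt (fun t ↦ P.qS t 0) (κ * (D0 * deriv P.mu s)) s := by
      have h := ((hT0.comp s hμ).const_mul κ).const_add (1 / 2 : ℝ)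
      refine h.congr_of_eventuallyEq ?_
      filter_upwards [hev] with t ht
      rw [qS_apply_zero, ht]; rfl
    have h1 : HasDerivAt (fun t ↦ P.qS t 1) (κ * (D1 * deriv P.mu s)) s := by
      have h := ((hT1.comp s hμ).const_mul κ).const_add (1 / 2 : ℝ)
      refine h.congr_of_eventuallyEq ?_
      filter_upwards [hev] with t ht
      rw [qS_apply_one, ht]; rfl
    have hy : P.qS s 1 - 1 / 2 = κ * tgt m 1 := by
      rw [qS_apply_one, P.hh_of_ge (by linarith) (by linarith)]; ring
    obtain ⟨-, ht1⟩ := tgt_mem hmm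
    have hab : |tgt m 1| ≤ 1 := abs_le.2 ⟨ht1.1, ht1.2⟩
    have hD0' : |D0| ≤ tgtLip := by
      refine hD0.trans ?_
      have hC := smoothTransitionDerivBound_pos
      unfold tgtLip
      have : 24 * smoothTransitionDerivBound / epsP ≤ 40 * smoothTransitionDerivBound / epsP :=
        div_le_div_of_nonneg_right (by nlinarith) hε.le
      have : 1 / epsP ≤ 2 / epsP := div_le_div_of_nonneg_right (by norm_num) hε.le
      linarith
    refine ⟨_, _, h0, h1, by positivity, ?_⟩
    rw [hy]
    -- `κ tgt₁ κ D0 μ' ≤ κ² |tgt₁| |D0| μ' ≤ κ μ' < 3 κ μ' ≤ 3 κ D1 μ'`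
    have hprod : |tgt m 1 * D0| ≤ tgtLip := by
      rw [abs_mul]
      calc |tgt m 1| * |D0| ≤ 1 * tgtLip := mul_le_mul hab hD0' (abs_nonneg _) zero_le_one
        _ = tgtLip := one_mul _
    have hle : κ * tgt m 1 * (κ * (D0 * deriv P.mu s)) ≤ κ * deriv P.mu s := by
      have e : κ * tgt m 1 * (κ * (D0 * deriv P.mu s)) = (κ * deriv P.mu s) * (κ * (tgt m 1 * D0)) := by ring
      rw [e]
      have h2 : κ * (tgt m 1 * D0) ≤ 1 := by
        have := (le_abs_self (tgt m 1 * D0)).trans hprod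
        nlinarith
      calc (κ * deriv P.mu s) * (κ * (tgt m 1 * D0)) ≤ (κ * deriv P.mu s) * 1 :=
            mul_le_mul_of_nonneg_left h2 (by positivity)
        _ = κ * deriv P.mu s := mul_one _
    have hlt : κ * deriv P.mu s < 3 * (κ * (D1 * deriv P.mu s)) := by
      have : κ * deriv P.mu s ≤ κ * (D1 * deriv P.mu s) := by
        apply mul_le_mul_of_nonneg_left _ hκ.le; nlinarith
      have hpos : 0 < κ * deriv P.mu s := by positivity
      linarith
    linarith

set_option maxHeartbeats 400000 in
/-- **Derivatives of the final track** on `[alo, ahi]` (for `κ tgtLip ≤ 1`): non-decreasing height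
and the turning condition. [folklore] -/
theorem cfam_one_derivs (hκt : κ * tgtLip ≤ 1) {s : ℝ} (hs : s ∈ Icc b.alo b.ahi) :
    ∃ d0 d1 : ℝ, HasDerivAt (fun t ↦ P.cfam 1 t 0) d0 s ∧ HasDerivAt (fun t ↦ P.cfam 1 t 1) d1 s ∧ 0 ≤ d1 ∧
      (P.cfam 1 s 1 - 1 / 2) * d0 < 3 * d1 := by
  obtain ⟨hb1, hb2, hb3, hb4, hb5, hb6, hb7, hb8, hb9, hεL, hεH, hb12, hb13⟩ := P.band_marks
  have hm := b.marks_lt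
  have hκ := P.HU.cone.spike.κ_pos
  have hκ12 := P.HU.cone.spike.κ_le
  have hq := P.paramLo_spec quarter_mem07; have hqc := P.paramLo_mem_core quarter_mem07
  have hq' := P.paramHi_spec quarter_mem07; have hqc' := P.paramHi_mem_core quarter_mem07
  have hsl := P.sLo_spec; have hsh := P.sHi_spec
  have hql : P.sLo < P.paramLo quarter_mem07 :=
    (P.alphaLo_lt_iff quarter_mem07 (P.paramLo_mem_core sixteenth_mem07)).1
      (by rw [show b.alphaLo κ (P.paramLo sixteenth_mem07) = 1 / 16 from hsl.1]; norm_num)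
  have hqh : P.paramHi quarter_mem07 < P.sHi :=
    (P.alphaHi_lt_iff quarter_mem07 (P.paramHi_mem_core sixteenth_mem07)).1
      (by rw [show b.alphaHi κ (P.paramHi sixteenth_mem07) = 1 / 16 from hsh.1]; norm_num)
  have h0 := P.paramLo_spec zero_mem07; have h0' := P.paramHi_spec zero_mem07
  have hcLo : b.alo + b.epsLo < b.tlo - b.epsLo := by linarith
  -- derivative data of the edge height functions
  have hfLo : HasDerivAt b.fLo (deriv b.fLo s) s := ((b.fLo_spec.1.differentiable (by simp)) s).hasDerivAt
  have hfUp : HasDerivAt b.fUp (deriv b.fUp s) s := ((b.fUp_spec.1.differentiable (by simp)) s).hasDerivAt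
  rcases lt_or_ge s P.sLo with hS1 | hS1
  · -- left of the moving interval
    have hst : s ∈ Icc (b.thetaA (3 / 20)) b.tlo := ⟨by linarith [hs.1], by linarith [hsl.2.2]⟩
    obtain ⟨hf, hfm⟩ := b.fLo_eq_heightA hst
    have hfpos : 0 < deriv b.fLo s := b.fLo_spec.2.2.1 s (by linarith [hst.2])
    by_cases h1 : s < b.alo + 3 / 2 * b.epsLo
    · -- the rail arch with height `fLo`
      have hev : P.cfam 1 =ᶠ[𝓝 s] fun t ↦ pt2 (b.chiLo t) (b.fLo t) := by
        filter_upwards [Iio_mem_nhds h1] with t (ht : t < b.alo + 3 / 2 * b.epsLo)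
        rw [P.cfam_of_lt_quarterLo (by linarith [hqc.1]), P.famLo_of_le ht.le]
        ext i; fin_cases i
        · rfl
        · show b.railLo t 1 = b.fLo t; rw [P.railLo_one_eq (by linarith), P.aLo_of_le ht.le]; ring
      have hX : HasDerivAt b.chiLo (deriv b.chiLo s) s := ((b.contDiff_chiLo.differentiable (by simp)) s).hasDerivAt
      have hXn : 0 ≤ deriv b.chiLo s := deriv_smoothStep_nonneg hcLo s
      refine ⟨deriv b.chiLo s, deriv b.fLo s, hX.congr_of_eventuallyEq (hev.mono fun t ht ↦ by simp only [ht, pt2_apply_zero]),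
        hfLo.congr_of_eventuallyEq (hev.mono fun t ht ↦ by simp only [ht, pt2_apply_one]), hfpos.le, ?_⟩
      have hy : P.cfam 1 s 1 = b.fLo s := by rw [hev.self_of_nhds, pt2_apply_one]
      rw [hy, hf]
      have : (b.heightA s - 1 / 2) * deriv b.chiLo s ≤ 0 := mul_nonpos_of_nonpos_of_nonneg (by linarith [hfm.2]) hXn
      linarith
    · -- the lower cleaning track `(χ₁, cleanLo)`
      push Not at h1
      have hev : P.cfam 1 =ᶠ[𝓝 s] fun t ↦ pt2 (b.railLo t 0) (P.cleanLo t) := by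
        filter_upwards [Iio_mem_nhds (hS1.trans hql)] with t (ht : t < P.paramLo quarter_mem07)
        rw [P.cfam_of_lt_quarterLo ht]
        ext i; fin_cases i
        · rfl
        · show P.famLo 1 t 1 = P.cleanLo t; rw [famLo_apply_one]; ring
      have hX : HasDerivAt (fun t ↦ b.railLo t 0) (deriv (fun t ↦ b.railLo t 0) s) s :=
        (((contDiff_euclidean.1 b.contDiff_railLo 0).differentiable (by simp)) s).hasDerivAt
      have hXpos : 0 < deriv (fun t ↦ b.railLo t 0) s := b.deriv_railLo_zero_pos ⟨by linarith, by linarith [hsl.2.2]⟩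
      have ha : HasDerivAt P.aLo (deriv P.aLo s) s := ((differentiable_smoothStep _ _) s).hasDerivAt
      have han : 0 ≤ deriv P.aLo s := deriv_smoothStep_nonneg (by linarith) s
      have ham := P.aLo_mem s
      have hC : HasDerivAt P.cleanLo ((0 - deriv P.aLo s) * b.fLo s + (1 - P.aLo s) * deriv b.fLo s + deriv P.aLo s * (1 / 2 - κ)) s := by
        have := (((hasDerivAt_const s (1:ℝ)).sub ha).mul hfLo).add (ha.mul_const (1 / 2 - κ))
        exact this
      refine ⟨_, _, hX.congr_of_eventuallyEq (hev.mono fun t ht ↦ by simp only [ht, pt2_apply_zero]),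
        hC.congr_of_eventuallyEq (hev.mono fun t ht ↦ by simp only [ht, pt2_apply_one]), ?_, ?_⟩
      · rw [hf]
        have h1' : 0 ≤ deriv P.aLo s * (1 / 2 - κ - b.heightA s) := mul_nonneg han (by linarith [hfm.2])
        have h2' : 0 ≤ (1 - P.aLo s) * deriv b.fLo s := mul_nonneg (by linarith [ham.2]) hfpos.le
        linarith
      · have hy : P.cfam 1 s 1 = P.cleanLo s := by rw [hev.self_of_nhds, pt2_apply_one]
        have hyle : P.cleanLo s ≤ 1 / 2 - κ := by
          have := (P.famLo_one_mem (u := 1) ⟨zero_le_one, le_rfl⟩ ⟨hs.1, hS1⟩).2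
          rwa [famLo_apply_one, sub_self, zero_mul, zero_add, one_mul] at this
        rw [hy, hf]
        have h1' : 0 ≤ deriv P.aLo s * (1 / 2 - κ - b.heightA s) := mul_nonneg han (by linarith [hfm.2])
        have h2' : 0 ≤ (1 - P.aLo s) * deriv b.fLo s := mul_nonneg (by linarith [ham.2]) hfpos.le
        have h3' : (P.cleanLo s - 1 / 2) * deriv (fun t ↦ b.railLo t 0) s < 0 :=
          mul_neg_of_neg_of_pos (by linarith) hXpos
        linarith
  rcases le_or_gt s P.sHi with hS2 | hS2
  · -- the moving interval
    obtain ⟨d0, d1, hd0, hd1, hn, ht⟩ := P.qS_derivs hκt ⟨hS1, hS2⟩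
    have hev : P.cfam 1 =ᶠ[𝓝 s] P.qS := by
      filter_upwards [Ioo_mem_nhds (show P.paramLo zero_mem07 < s by linarith [P.marks.1]) (show s < P.paramHi zero_mem07 by linarith [P.marks.2.2])]
        with t ht using P.cfam_of_mem_region ht
    refine ⟨d0, d1, hd0.congr_of_eventuallyEq (hev.mono fun t ht ↦ by simp only [ht]), hd1.congr_of_eventuallyEq (hev.mono fun t ht ↦ by simp only [ht]), hn, ?_⟩
    rwa [P.cfam_of_mem_S ⟨hS1, hS2⟩]
  · -- right of the moving interval
    have hst : s ∈ Icc b.thi (b.thetaA (17 / 20)) := ⟨by linarith [hsh.2.1], by linarith [hs.2]⟩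
    obtain ⟨hf, hfm⟩ := b.fUp_eq_heightA hst
    have hfpos : 0 < deriv b.fUp s := b.fUp_spec.2.2.1 s (by linarith [hst.1])
    have hcHi : -b.ahi + b.epsHi < -b.thi - b.epsHi := by linarith
    by_cases h1 : b.ahi - 3 / 2 * b.epsHi < s
    · -- the upper rail arch with height `fUp`
      have hev : P.cfam 1 =ᶠ[𝓝 s] fun t ↦ pt2 (b.chiHi t) (b.fUp t) := by
        filter_upwards [Ioi_mem_nhds h1] with t (ht : b.ahi - 3 / 2 * b.epsHi < t)
        rw [P.cfam_of_quarterHi_lt (by linarith [hqc'.2]), P.famUp_of_ge ht.le]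
        ext i; fin_cases i
        · rfl
        · show b.railUp t 1 = b.fUp t; rw [P.railUp_one_eq (by linarith), P.aUp_of_ge ht.le]; ring
      have hX : HasDerivAt b.chiHi (deriv (smoothStep (-b.ahi + b.epsHi) (-b.thi - b.epsHi)) (-s) * (-1)) s := by
        have h := ((differentiable_smoothStep (-b.ahi + b.epsHi) (-b.thi - b.epsHi)) (-s)).hasDerivAt
        exact h.comp s (hasDerivAt_neg s)
      have hXn : deriv (smoothStep (-b.ahi + b.epsHi) (-b.thi - b.epsHi)) (-s) * (-1) ≤ 0 := by
        have := deriv_smoothStep_nonneg hcHi (-s); linarith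
      refine ⟨_, deriv b.fUp s, hX.congr_of_eventuallyEq (hev.mono fun t ht ↦ by simp only [ht, pt2_apply_zero]),
        hfUp.congr_of_eventuallyEq (hev.mono fun t ht ↦ by simp only [ht, pt2_apply_one]), hfpos.le, ?_⟩
      have hy : P.cfam 1 s 1 = b.fUp s := by rw [hev.self_of_nhds, pt2_apply_one]
      rw [hy, hf]
      have : (b.heightA s - 1 / 2) * (deriv (smoothStep (-b.ahi + b.epsHi) (-b.thi - b.epsHi)) (-s) * (-1)) ≤ 0 :=
        mul_nonpos_of_nonneg_of_nonpos (by linarith [hfm.1]) hXn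
      linarith
    · -- the upper cleaning track `(chiHi, cleanUp)`
      push Not at h1
      have hev : P.cfam 1 =ᶠ[𝓝 s] fun t ↦ pt2 (b.railUp t 0) (P.cleanUp t) := by
        filter_upwards [Ioi_mem_nhds (hqh.trans hS2)] with t (ht : P.paramHi quarter_mem07 < t)
        rw [P.cfam_of_quarterHi_lt ht]
        ext i; fin_cases i
        · rfl
        · show P.famUp 1 t 1 = P.cleanUp t; rw [famUp_apply_one]; ring
      have hX : HasDerivAt (fun t ↦ b.railUp t 0) (deriv (fun t ↦ b.railUp t 0) s) s :=
        (((contDiff_euclidean.1 b.contDiff_railUp 0).differentiable (by simp)) s).hasDerivAt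
      have hXneg : deriv (fun t ↦ b.railUp t 0) s < 0 := deriv_railUp_zero_neg (b := b) ⟨by linarith [hsh.2.1], by linarith⟩
      have ha : HasDerivAt P.aUp (deriv (smoothStep (-b.ahi + 3 / 2 * b.epsHi) (-b.ahi + 2 * b.epsHi)) (-s) * (-1)) s := by
        have h := ((differentiable_smoothStep (-b.ahi + 3 / 2 * b.epsHi) (-b.ahi + 2 * b.epsHi)) (-s)).hasDerivAt
        exact h.comp s (hasDerivAt_neg s)
      set a' := deriv (smoothStep (-b.ahi + 3 / 2 * b.epsHi) (-b.ahi + 2 * b.epsHi)) (-s) * (-1) with ha'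
      have han : a' ≤ 0 := by
        have := deriv_smoothStep_nonneg (show -b.ahi + 3 / 2 * b.epsHi < -b.ahi + 2 * b.epsHi by linarith) (-s); rw [ha']; linarith
      have ham := P.aUp_mem s
      have hC : HasDerivAt P.cleanUp ((0 - a') * b.fUp s + (1 - P.aUp s) * deriv b.fUp s + a' * (1 / 2 + κ)) s := by
        have := (((hasDerivAt_const s (1:ℝ)).sub ha).mul hfUp).add (ha.mul_const (1 / 2 + κ))
        exact this
      refine ⟨_, _, hX.congr_of_eventuallyEq (hev.mono fun t ht ↦ by simp only [ht, pt2_apply_zero]),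
        hC.congr_of_eventuallyEq (hev.mono fun t ht ↦ by simp only [ht, pt2_apply_one]), ?_, ?_⟩
      · rw [hf]
        have h1' : 0 ≤ a' * (1 / 2 + κ - b.heightA s) := mul_nonneg_of_nonpos_of_nonpos han (by linarith [hfm.1])
        have h2' : 0 ≤ (1 - P.aUp s) * deriv b.fUp s := mul_nonneg (by linarith [ham.2]) hfpos.le
        linarith
      · have hy : P.cfam 1 s 1 = P.cleanUp s := by rw [hev.self_of_nhds, pt2_apply_one]
        have hyge : 1 / 2 + κ ≤ P.cleanUp s := by
          have := (P.famUp_one_mem (u := 1) ⟨zero_le_one, le_rfl⟩ ⟨hS2, hs.2⟩).1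
          rwa [famUp_apply_one, sub_self, zero_mul, zero_add, one_mul] at this
        rw [hy, hf]
        have h1' : 0 ≤ a' * (1 / 2 + κ - b.heightA s) := mul_nonneg_of_nonpos_of_nonpos han (by linarith [hfm.1])
        have h2' : 0 ≤ (1 - P.aUp s) * deriv b.fUp s := mul_nonneg (by linarith [ham.2]) hfpos.le
        have h3' : (P.cleanUp s - 1 / 2) * deriv (fun t ↦ b.railUp t 0) s < 0 :=
          mul_neg_of_pos_of_neg (by linarith) hXneg
        linarith

/-! ### The edge loop and the conclusion -/

section Final

variable {ε₁ r₁ : ℝ} (hf₁ : b.IsFlat hcross ε₁ r₁) (hε₁ : ε₁ ≤ epsU) (hr₁ : 4 * κ < r₁) (hκt : κ * tgtLip ≤ 1)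
include hf₁ hε₁ hr₁ hκt

/-- **The cleaned knot is an edge loop** (turning height `1/2`). [folklore] -/
theorem edgeLoop : b.EdgeLoop (P.cleanKnot hf₁ hε₁ hr₁) (P.cfam 1) b.alo (b.alo + b.epsLo) (b.ahi - b.epsHi) b.ahi (1 / 2) := by
  obtain ⟨hb1, hb2, hb3, hb4, hb5, hb6, hb7, hb8, hb9, hεL, hεH, hb12, hb13⟩ := P.band_marks
  have hm := b.marks_lt
  have hκ := P.HU.cone.spike.κ_pos
  have hκ12 := P.HU.cone.spike.κ_le
  have hsl := P.sLo_spec; have hsh := P.sHi_spec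
  have hF := P.planarFamily hf₁ hε₁ hr₁
  have hw := b.thetaA_window
  have hms := P.margin_spec
  have hAm := b.heightA_marks
  refine
    { hp := ⟨hm.1.trans hm.2.1, by linarith, by linarith, by linarith, hb8.trans hb9⟩
      contDiff := P.contDiff_cfam.comp (contDiff_const.prodMk contDiff_id)
      curve_eq := fun s hs ↦ by rw [Knot.curve_apply, cleanKnot, hF.outKnot_circlePt_of_mem hs]
      off := fun t ht hts ↦ ?_
      edge := fun s hs hs' ↦ ?_
      mem := fun s hs ↦ P.cfam_mem (u := 1) ⟨zero_le_one, le_rfl⟩ hs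
      pos := fun s hs ↦ ?_
      lt_one := fun s hs ↦ ?_
      injOn := P.injOn_cfam hf₁ hε₁ hr₁ (u := 1) ⟨zero_le_one, le_rfl⟩
      mono := fun s hs ↦ ?_
      turn := fun s hs ↦ ?_
      straddle := by rw [hAm.1, hAm.2.2.2]; norm_num }
  · -- off `(alo, ahi)` the cleaned knot is `A`
    by_cases hI : t ∈ Icc b.alo b.ahi
    · have hend : t = b.alo ∨ t = b.ahi := by
        rcases eq_or_lt_of_le hI.1 with h | h
        · exact Or.inl h.symm
        · rcases eq_or_lt_of_le hI.2 with h' | h'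
          · exact Or.inr h'
          · exact absurd ⟨h, h'⟩ hts
      rw [cleanKnot, hF.outKnot_circlePt_of_mem hI]
      rcases hend with rfl | rfl
      · rw [show P.cfam 1 b.alo = P.famLo 1 b.alo by simp [cfam, hb4.trans' (by linarith : b.alo < b.tcLo - b.epsLo / 2)],
          P.famLo_of_le (by linarith), b.band_railLo_eq_A ⟨hm.2.1.le, by linarith⟩]
      · rw [show P.cfam 1 b.ahi = P.famUp 1 b.ahi by
            simp [cfam, not_lt.2 (show P.sLo ≤ b.ahi by linarith), not_le.2 (show P.sHi < b.ahi by linarith)],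
          P.famUp_of_ge (by linarith), b.band_railUp_eq_A ⟨by linarith, hb8.le⟩]
    · rw [cleanKnot, hF.outKnot_circlePt_of_not_mem ht hI, P.outKnot_circlePt_eq_A hf₁ hε₁ hr₁ ht hI]
  · -- the edge zones
    rcases le_or_gt s (b.alo + b.epsLo) with h1 | h1
    · rw [show P.cfam 1 s = P.famLo 1 s by simp [cfam, show s < P.sLo by linarith], P.famLo_of_le (by linarith),
        b.railLo_eq_left h1, (b.fLo_eq_heightA ⟨by linarith [hs.1], by linarith⟩).1]
    · have h2 : b.ahi - b.epsHi ≤ s := by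
        by_contra hc; push Not at hc; exact hs' ⟨h1, hc⟩
      rw [show P.cfam 1 s = P.famUp 1 s by
          simp [cfam, not_lt.2 (show P.sLo ≤ s by linarith), not_le.2 (show P.sHi < s by linarith)],
        P.famUp_of_ge (by linarith), b.railUp_eq_left h2, (b.fUp_eq_heightA ⟨by linarith, by linarith [hs.2]⟩).1]
  · -- positive first coordinate inside
    rcases lt_or_ge s P.sLo with h1 | h1
    · rw [show P.cfam 1 s = P.famLo 1 s by simp [cfam, h1], famLo_apply_zero]
      exact (b.railLo_zero_mem_Ioo ⟨hs.1, by linarith [hsl.2.2]⟩).1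
    rcases le_or_gt s P.sHi with h2 | h2
    · rw [P.cfam_of_mem_S ⟨h1, h2⟩]; linarith [(P.qS_zero_mem ⟨h1, h2⟩).1]
    · rw [show P.cfam 1 s = P.famUp 1 s by simp [cfam, not_lt.2 h1, not_le.2 h2], famUp_apply_zero]
      exact (b.railUp_zero_mem_Ioo ⟨by linarith [hsh.2.1], hs.2⟩).1
  · -- first coordinate `< 1`
    rcases lt_or_ge s P.sLo with h1 | h1
    · rw [show P.cfam 1 s = P.famLo 1 s by simp [cfam, h1], famLo_apply_zero]
      linarith [P.railLo_zero_lt_of_lt_sLo h1]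
    rcases le_or_gt s P.sHi with h2 | h2
    · rw [P.cfam_of_mem_S ⟨h1, h2⟩]; linarith [(P.qS_zero_mem ⟨h1, h2⟩).2]
    · rw [show P.cfam 1 s = P.famUp 1 s by simp [cfam, not_lt.2 h1, not_le.2 h2], famUp_apply_zero]
      linarith [P.railUp_zero_lt_of_sHi_lt h2]
  · obtain ⟨d0, d1, -, hd1, hn, -⟩ := P.cfam_one_derivs hκt hs
    rw [hd1.deriv]; exact hn
  · obtain ⟨d0, d1, hd0, hd1, -, ht⟩ := P.cfam_one_derivs hκt hs
    rw [hd0.deriv, hd1.deriv]; exact ht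

/-- The cleaned knot is isotopic to `A`. [folklore] -/
theorem isIsotopic_cleanKnot_A : (P.cleanKnot hf₁ hε₁ hr₁).IsIsotopic A := (P.edgeLoop hf₁ hε₁ hr₁ hκt).isIsotopic

/-- **THE CLOSURE LEMMA: the instance host knot is isotopic to the first summand `A`.** Crossing
retraction (`isIsotopic_host_outKnot`), cleaning of the arches (`isIsotopic_outKnot_cleanKnot`),
edge loop (`isIsotopic_cleanKnot_A`), composed by transitivity of isotopy (Hirsch, Ch. 8 §1).
[cite: HirschDT1976, Ch. 8 §1, Thm. 1.3] -/
theorem isIsotopic_host_A : P.host.IsIsotopic A :=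
  SphereEmbedding.IsIsotopic.trans_holds (P.isIsotopic_host_outKnot hf₁ hε₁ hr₁)
    (SphereEmbedding.IsIsotopic.trans_holds (P.isIsotopic_outKnot_cleanKnot hf₁ hε₁ hr₁) (P.isIsotopic_cleanKnot_A hf₁ hε₁ hr₁ hκt))

end Final

end HostHyp

end BandData

end Literature.Topology.FourManifolds
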